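/-
Copyright (c) 2026 the pub-hodgecm-mathlib formalisation cell (harness21).  Prover seat hodgecm-mathlib-F0P3a-p02 (g17): road «S3-ram» (junction pen F0P3a-p01 (g17),
J-PACK v2 (f) isoceles wave), socket S45-BARE «POOLED REGION DATA of a BARE isoceles literal»; 2026-09-02.
-/
import Literature.NumberTheory.Automorphic.UnitaryLatticeTreeSliceCountKeyedRamified          -- ★ p847638 (F0P2-p06): ROOT-SLICE κ-keyed
import Literature.NumberTheory.Automorphic.UnitaryLatticeTreeOffRegionGrandchildLabelsRamified  -- ★ p847608 (F0P3a-p04): S2 labels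
import Literature.NumberTheory.Automorphic.UnitaryLatticeTreeResidualEigenframeRamified        -- ★ p847807∕p847889 (this seat): G3⁶ residual eigenframe; brings ★ G3⁗ bridge
import Literature.NumberTheory.Automorphic.UnitaryLatticeTreeRankOneVertexOneClassRamified      -- ★ 1C (F0P2-p01): one class per rank-one vertex
import Literature.NumberTheory.Automorphic.UnitaryLatticeTreeIsocelesRegionDistanceRamified     -- ★ p847820 (F0P3-p03): the anisotropic twin `R = {r₀}`
import Literature.NumberTheory.Automorphic.UnitaryLatticeTreeFramesOfInvolution               -- ★ `isTree_latticeGraph_three_of_neg`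
import Literature.NumberTheory.Automorphic.UnitaryLatticeTreeFixedGrandchildFrameRamified       -- ★ `latticeGraphIso_root_eq_of_mem_unitaryInt`
import Literature.NumberTheory.Automorphic.UnitaryLatticeTreeFixedChildCountTransportRamified   -- ★ `latticeGraphIso_one_apply`
import Literature.NumberTheory.Rogawski1990.DepthZeroKappaTransferTypeOneRamifiedIsocelesRootCensus  -- ★ p847712 (this seat): the root census
import HarnessLib

/-!
# The lattice graph of a hermitian space — THE POOLED REGION DATA OF A BARE ISOCELES LITERAL at a tamely ramified place: `R = {r₀}`, no E-grandchild, and all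
# `q(q+1)` off-region root grandchildren in ONE class (Rogawski 1990 §4.9; Kottwitz 1986 §3; Bruhat–Tits 1972 §10)

Topic `NumberTheory/Automorphic`; namespace `Literature.NumberTheory.Automorphic.UnitaryLatticeTree`.  THEOREMS ONLY (no definition, no instance, no notation, no named fact,
no `sorry`); kernel lane `--supports stmt-HodgeConjecture-24833`.  Cell `pub/hodgecm-mathlib` (D-0151), crux H413; road «S3-ram» (count-neutral); junction J-PACK v2
(F0P3a-p01 (g17)), iso engine `strataCount_J₀_isoceles` (skeleton v11 :1107), socket **S45-BARE** = `row_S45_bare` of the hand's cut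
`F0/P3a/F0P3a-p02/g17/iso/JunctionSocketsS45.statementfirst.v4.F0P3ap02g17.lean` :75 (binders 0–41 = the engine's VERBATIM, then `(s' hs' hgap) {j k} (hj hk hjk) (haniso)`).

THE MATHEMATICS.  An isoceles literal `γ = A·diag(s)·A⁻¹` whose root plane `ū_{i₀}^⊥` is residually ANISOTROPIC (`haniso`: no unit `t` with `|d_j + tσ(t)d_k| < 1`, ★ F0P3-p03's
token): (i) the root region is the bare root, `sR = {r₀}` (★ `eq_stdLattice_of_lev_of_anisotropic`); (ii) no root line is null and ALL `q + 1` root lines have their depth-`d₀`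
value in the ONE class `C = (ϖ^{d₀})⁻¹(s_{i₀} − s_j)·d_{i₀}∕(−det diag d)` (★ root census `natCard_params_rootFrame_pred_eq` over ★ G3⁶ and the ★ root bridge G3⁗, with
`χ(−δ_jδ_k) = −1`); (iii) by ★ S2 every far vertex through a root child carries the P-label `(d₀−2, 1, CLS(−value))`, hence the engine's P-token (class `c₁`) iff
`lock : C ∈ −c₁·□` and the M-token iff `¬lock` (★ 1C exclusivity + the residue dichotomy against the non-square `ε`), and never the E-token; (iv) ★ ROOT-SLICE κ-keyed
multiplies by `q`.  Result (the engine's currency): **`sR.card = 1`, `ΣE = q·0`, `ΣP = q·(q+1)·[lock]`, `ΣM = q·(q+1)·[¬lock]`**.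
HONEST LABEL: HC_CM is proved only modulo the 2 remaining named inputs (hLiu418 24832, h413 24833) until rung 0 closes; nothing printed is asserted here.

## References
* [Rogawski1990] J. D. Rogawski, *Automorphic Representations of Unitary Groups in Three Variables*, Ann. of Math. Stud. 123 (1990), §4.9 Prop. 4.9.1 p. 55.
* [Kottwitz1986] R. E. Kottwitz, *Base change for unit elements of Hecke algebras*, Compositio Math. 60 (1986), §3.
* [BruhatTits1972] F. Bruhat, J. Tits, *Groupes réductifs sur un corps local I*, Publ. Math. IHÉS 41 (1972), §10.
-/

set_option autoImplicit false

noncomputable section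

open scoped Valued WithZero Matrix MatrixGroups
open Polynomial Classical SimpleGraph
open Literature.NumberTheory.Automorphic Literature.NumberTheory.Automorphic.HermitianLattice
open Literature.NumberTheory.Automorphic.CartanUnique Literature.NumberTheory.Automorphic.UnitaryGroup
open Literature.NumberTheory.Rogawski1990

namespace Literature.NumberTheory.Automorphic.UnitaryLatticeTree

variable {K : Type*} [Field K] [Valued K ℤᵐ⁰] {σ : K →+* K} {ϖ : K}

set_option maxHeartbeats 1600000 in
/-- **S45-BARE «POOLED REGION DATA, anisotropic root plane»** (socket∕supplier): `R = {r₀}` (★∕GREEN F0P3-p03 `eq_stdLattice_of_lev_of_anisotropic`), no null root line,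
all `q + 1` root lines of class `C`, each carrying `q` off-region grandchildren with the P-token iff `lock`, the M-token iff `¬lock` (★ ROOT-SLICE ∘ ★ S2 ∘ ★ G3⁗ ∘
★ root census p847712 ∘ G3⁶ ∘ ★ 1C). [cite: Rogawski1990, §4.9 Prop. 4.9.1 p. 55] [cite: Kottwitz1986, §3] [cite: BruhatTits1972, §10] -/
theorem isoceles_bare_regionCard_and_tokenCounts [ValuativeRel K] [(Valued.v : Valuation K ℤᵐ⁰).Compatible]
    (hσ : ∀ x, σ (σ x) = x) (hvσ : ∀ a, Valued.v (σ a) = Valued.v a) (hσϖ : σ ϖ = -ϖ)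
    (hϖ : Valued.v ϖ = WithZero.exp (-1 : ℤ)) (hres : ∀ x : K, Valued.v x ≤ 1 → Valued.v (σ x - x) < 1) (h2 : Valued.v (2 : K) = 1)
    (hnorm : ∀ u : K, σ u = u → Valued.v (u - 1) < 1 → ∃ z : K, z * σ z = u ∧ Valued.v (z - 1) ≤ Valued.v (u - 1)) [Fintype 𝓀[K]] [DecidableEq 𝓀[K]]
    {γ : unitaryGroupOfForm σ ((StdForm.antidiagonal 3).over K)} (hγ0 : γ ∈ unitaryInt σ ((StdForm.antidiagonal 3).over K))
    (d : Fin 3 → K) (hd : ∀ i, Valued.v (d i) = 1) (hdσ : ∀ i, σ (d i) = d i)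
    (A : GL (Fin 3) K) (hA : IsIntMatrix (A : Matrix (Fin 3) (Fin 3) K)) (hA' : IsIntMatrix ((A⁻¹ : GL (Fin 3) K) : Matrix (Fin 3) (Fin 3) K))
    (hdA : Matrix.diagonal d = (-(Matrix.diagonal d).det) • formCongr σ A ((StdForm.antidiagonal 3).over K))
    (s : Fin 3 → K) (hs1 : s 1 = 1) (hsv : ∀ i, Valued.v (s i) = 1) (hsσ : ∀ i, s i * σ (s i) = 1)
    (hγA : ((γ : GL (Fin 3) K) : Matrix (Fin 3) (Fin 3) K) = (A : Matrix (Fin 3) (Fin 3) K) * Matrix.diagonal s * ((A⁻¹ : GL (Fin 3) K) : Matrix (Fin 3) (Fin 3) K))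
    (i₀ : Fin 3) {d₀ : ℕ} (hd3 : 3 ≤ d₀) (he : ∀ i, Valued.v (s i - 1) ≤ Valued.v ϖ ^ d₀)
    (hiso : ∀ j, j ≠ i₀ → Valued.v (s i₀ - s j) = Valued.v ϖ ^ d₀) (hclose : ∀ j k, j ≠ i₀ → k ≠ i₀ → Valued.v (s j - s k) ≤ Valued.v ϖ ^ (d₀ + 2))
    (_hreg : ∀ i j, i ≠ j → s i ≠ s j)
    (mA : ℕ) (hmA : d₀ = 2 * mA + 3)
    (c₁ ε : K) (hc₁ : Valued.v c₁ = 1) (hεv : Valued.v ε = 1) (hε : ∀ z : K, Valued.v z ≤ 1 → Valued.v (z ^ 2 - ε) = 1)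
    (q : ℕ) (hq : q = Fintype.card 𝓀[K])
    (sR : Finset {M : Submodule 𝒪[K] (Fin 3 → K) // IsVertex σ ϖ ((StdForm.antidiagonal 3).over K) M}) (hsR : ∀ v, v ∈ sR ↔ v ∈ {v : {M : Submodule 𝒪[K] (Fin 3 → K) // IsVertex σ ϖ ((StdForm.antidiagonal 3).over K) M} | latticeGraphIso σ ϖ ((StdForm.antidiagonal 3).over K) γ v = v ∧ IsSelfDualLattice σ ϖ ((StdForm.antidiagonal 3).over K) v.1 ∧ v.1.map ((Matrix.toLin' (((γ : GL (Fin 3) K) : Matrix (Fin 3) (Fin 3) K) - 1)).restrictScalars 𝒪[K]) ≤ scaleLattice (ϖ ^ d₀) v.1})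
    (s' : ℕ) (_hs' : 1 ≤ s') (hgap : ∀ j k, j ≠ i₀ → k ≠ i₀ → j ≠ k → Valued.v (s j - s k) = Valued.v ϖ ^ (d₀ + 2 * s'))
    {j k : Fin 3} (hj : j ≠ i₀) (hk : k ≠ i₀) (hjk : j ≠ k)
    (haniso : ¬ ∃ t : K, Valued.v t = 1 ∧ Valued.v (d j + t * σ t * d k) < 1) :
    sR.card = 1 ∧
    ∑ v ∈ sR, ({w | w ∈ {w | ∃ c, ((latticeGraph σ ϖ ((StdForm.antidiagonal 3).over K)).Adj v c ∧ (latticeGraph σ ϖ ((StdForm.antidiagonal 3).over K)).dist ⟨stdLattice K 3, 0, isSelfDualLattice_stdLattice_three_of_v hϖ⟩ c = (latticeGraph σ ϖ ((StdForm.antidiagonal 3).over K)).dist ⟨stdLattice K 3, 0, isSelfDualLattice_stdLattice_three_of_v hϖ⟩ v + 1 ∧ latticeGraphIso σ ϖ ((StdForm.antidiagonal 3).over K) γ c = c) ∧ ((latticeGraph σ ϖ ((StdForm.antidiagonal 3).over K)).Adj c w ∧ (latticeGraph σ ϖ ((StdForm.antidiagonal 3).over K)).dist ⟨stdLattice K 3,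 0, isSelfDualLattice_stdLattice_three_of_v hϖ⟩ w = (latticeGraph σ ϖ ((StdForm.antidiagonal 3).over K)).dist ⟨stdLattice K 3, 0, isSelfDualLattice_stdLattice_three_of_v hϖ⟩ c + 1 ∧ latticeGraphIso σ ϖ ((StdForm.antidiagonal 3).over K) γ w = w)} ∧ (¬ w.1.map ((Matrix.toLin' (((γ : GL (Fin 3) K) : Matrix (Fin 3) (Fin 3) K) - 1)).restrictScalars 𝒪[K]) ≤ scaleLattice (ϖ ^ d₀) w.1 ∧ (w.1.map ((Matrix.toLin' (((γ : GL (Fin 3) K) : Matrix (Fin 3) (Fin 3) K) - 1)).restrictScalars 𝒪[K]) ≤ scaleLattice (ϖ ^ (d₀ - 1)) w.1 ∧ ¬ w.1.map ((Matrix.toLin' (((γ : GL (Fin 3) K) : Matrix (Fin 3) (Fin 3) K) - 1)).restrictScalars 𝒪[K]) ≤ scaleLattice (ϖ ^ d₀) w.1))}).ncard = q * 0 ∧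
    ∑ v ∈ sR, ({w | w ∈ {w | ∃ c, ((latticeGraph σ ϖ ((StdForm.antidiagonal 3).over K)).Adj v c ∧ (latticeGraph σ ϖ ((StdForm.antidiagonal 3).over K)).dist ⟨stdLattice K 3, 0, isSelfDualLattice_stdLattice_three_of_v hϖ⟩ c = (latticeGraph σ ϖ ((StdForm.antidiagonal 3).over K)).dist ⟨stdLattice K 3, 0, isSelfDualLattice_stdLattice_three_of_v hϖ⟩ v + 1 ∧ latticeGraphIso σ ϖ ((StdForm.antidiagonal 3).over K) γ c = c) ∧ ((latticeGraph σ ϖ ((StdForm.antidiagonal 3).over K)).Adj c w ∧ (latticeGraph σ ϖ ((StdForm.antidiagonal 3).over K)).dist ⟨stdLattice K 3, 0, isSelfDualLattice_stdLattice_three_of_v hϖ⟩ w = (latticeGraph σ ϖ ((StdForm.antidiagonal 3).over K)).dist ⟨stdLattice K 3, 0, isSelfDualLattice_stdLattice_three_of_v hϖ⟩ c + 1 ∧ latticeGraphIso σ ϖ ((StdForm.antidiagonal 3).over K) γ w = w)} ∧ (¬ w.1.map ((Matrix.toLin' (((γ : GL (Fin 3) K) : Matrix (Fin 3) (Fin 3)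 K) - 1)).restrictScalars 𝒪[K]) ≤ scaleLattice (ϖ ^ d₀) w.1 ∧ (w.1.map ((Matrix.toLin' (((γ : GL (Fin 3) K) : Matrix (Fin 3) (Fin 3) K) - 1)).restrictScalars 𝒪[K]) ≤ scaleLattice (ϖ ^ (d₀ - 2)) w.1 ∧ ¬ w.1.map ((Matrix.toLin' (((γ : GL (Fin 3) K) : Matrix (Fin 3) (Fin 3) K) - 1)).restrictScalars 𝒪[K]) ≤ scaleLattice (ϖ ^ (d₀ - 1)) w.1) ∧ ∃ y ∈ w.1, ∃ a : K, Valued.v a = 1 ∧ Valued.v ((ϖ ^ (d₀ - 2))⁻¹ * pairing σ ((StdForm.antidiagonal 3).over K) y ((((γ : GL (Fin 3) K) : Matrix (Fin 3) (Fin 3) K) - 1) *ᵥ y) - (c₁) * a ^ 2) < 1)}).ncard = q * (if (∃ a : K, Valued.v a = 1 ∧ Valued.v (((ϖ ^ d₀)⁻¹ * (s i₀ - s j) * (d i₀ * (-(Matrix.diagonal d).det)⁻¹)) + c₁ * a ^ 2) < 1) then q + 1 else 0) ∧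
    ∑ v ∈ sR, ({w | w ∈ {w | ∃ c, ((latticeGraph σ ϖ ((StdForm.antidiagonal 3).over K)).Adj v c ∧ (latticeGraph σ ϖ ((StdForm.antidiagonal 3).over K)).dist ⟨stdLattice K 3, 0, isSelfDualLattice_stdLattice_three_of_v hϖ⟩ c = (latticeGraph σ ϖ ((StdForm.antidiagonal 3).over K)).dist ⟨stdLattice K 3, 0, isSelfDualLattice_stdLattice_three_of_v hϖ⟩ v + 1 ∧ latticeGraphIso σ ϖ ((StdForm.antidiagonal 3).over K) γ c = c) ∧ ((latticeGraph σ ϖ ((StdForm.antidiagonal 3).over K)).Adj c w ∧ (latticeGraph σ ϖ ((StdForm.antidiagonal 3).over K)).dist ⟨stdLattice K 3, 0, isSelfDualLattice_stdLattice_three_of_v hϖ⟩ w = (latticeGraph σ ϖ ((StdForm.antidiagonal 3).over K)).dist ⟨stdLattice K 3, 0, isSelfDualLattice_stdLattice_three_of_v hϖ⟩ c + 1 ∧ latticeGraphIso σ ϖ ((StdForm.antidiagonal 3).over K) γ w = w)} ∧ (¬ w.1.map ((Matrix.toLin' (((γ : GL (Fin 3) K) : Matrix (Fin 3) (Fin 3)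 K) - 1)).restrictScalars 𝒪[K]) ≤ scaleLattice (ϖ ^ d₀) w.1 ∧ (w.1.map ((Matrix.toLin' (((γ : GL (Fin 3) K) : Matrix (Fin 3) (Fin 3) K) - 1)).restrictScalars 𝒪[K]) ≤ scaleLattice (ϖ ^ (d₀ - 2)) w.1 ∧ ¬ w.1.map ((Matrix.toLin' (((γ : GL (Fin 3) K) : Matrix (Fin 3) (Fin 3) K) - 1)).restrictScalars 𝒪[K]) ≤ scaleLattice (ϖ ^ (d₀ - 1)) w.1) ∧ ¬ (∃ y ∈ w.1, ∃ a : K, Valued.v a = 1 ∧ Valued.v ((ϖ ^ (d₀ - 2))⁻¹ * pairing σ ((StdForm.antidiagonal 3).over K) y ((((γ : GL (Fin 3) K) : Matrix (Fin 3) (Fin 3) K) - 1) *ᵥ y) - (c₁) * a ^ 2) < 1))}).ncard = q * (if (∃ a : K, Valued.v a = 1 ∧ Valued.v (((ϖ ^ d₀)⁻¹ * (s i₀ - s j) * (d i₀ * (-(Matrix.diagonal d).det)⁻¹)) + c₁ * a ^ 2) < 1) then 0 else q + 1) := by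
  have hϖ0 : ϖ ≠ 0 := fun h0 => by rw [h0, map_zero] at hϖ; exact WithZero.coe_ne_zero hϖ.symm
  have hvϖ0 : Valued.v ϖ ≠ 0 := (Valuation.ne_zero_iff _).2 hϖ0
  have hϖle1 : Valued.v ϖ ≤ 1 := by rw [hϖ, ← WithZero.exp_zero]; exact WithZero.exp_le_exp.2 (by norm_num)
  have hres0 : ∀ x : 𝒪[K], IsLocalRing.residue 𝒪[K] x = 0 ↔ Valued.v (x : K) < 1 := residue_eq_zero_iff_v_lt_one
  have hqk : Nat.card 𝓀[K] = q := by rw [hq, Nat.card_eq_fintype_card]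
  have hk2 : ringChar 𝓀[K] ≠ 2 := by
    intro hc
    have h := (ringChar.spec 𝓀[K] 2).2 (by rw [hc])
    have h2' : ((2 : ℕ) : 𝓀[K]) = IsLocalRing.residue 𝒪[K] 2 := by push_cast; exact (map_ofNat _ 2).symm
    rw [h2', hres0] at h
    exact absurd (show Valued.v (2 : K) < 1 from h) (by rw [h2]; exact lt_irrefl 1)
  have hT := isTree_latticeGraph_three_of_neg hσ hvσ hϖ hσϖ hres h2 hnorm
  have hd1 : 1 ≤ d₀ - 2 := by omega
  -- ### 1. the residual eigenframe (★ G3⁶ ED. 2) and the anisotropy `χ(−δ_jδ_k) = −1`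
  obtain ⟨Ab, Y₀, δ, y, hY₀, hG, hδ0, hY, hyeq, hyne, hdict, hδpin, hypin⟩ :=
    exists_residualEigenframe_of_isoceles' hvσ hres hϖ d hd A hA hA' hdA s hγA i₀ he hiso hclose
  have hχ : quadraticChar 𝓀[K] (-(δ j * δ k)) = -1 := by
    rcases quadraticChar_dichotomy (neg_ne_zero.2 (mul_ne_zero (hδ0 j) (hδ0 k))) with h | h
    · exact absurd ((hdict j k hj hk hjk).2 h) haniso
    · exact h
  have hCne : ((y i₀ - y j) * δ i₀) ≠ 0 := mul_ne_zero (sub_ne_zero.2 (hyne j hj)) (hδ0 i₀)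
  -- ### 2. entry bounds of `γ − 1`, the root tokens
  have hent : ∀ i j, Valued.v ((((γ : GL (Fin 3) K) : Matrix (Fin 3) (Fin 3) K) - 1) i j) ≤ Valued.v ϖ ^ d₀ := fun i j => by
    have h' : (((γ : GL (Fin 3) K) : Matrix (Fin 3) (Fin 3) K) - 1) i j = ϖ ^ d₀ * ((Y₀ i j : 𝒪[K]) : K) := by
      rw [hY₀ i j, ← mul_assoc, mul_inv_cancel₀ (pow_ne_zero _ hϖ0), one_mul]
    rw [h', map_mul, map_pow]
    exact mul_le_of_le_one_right' (Y₀ i j).2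
  have hdeep : ∀ i j, Valued.v ((((γ : GL (Fin 3) K) : Matrix (Fin 3) (Fin 3) K) - 1) i j) ≤ Valued.v ϖ ^ 2 := fun i j =>
    (hent i j).trans (pow_le_pow_right_of_le_one' hϖle1 (by omega))
  have hr_fix : latticeGraphIso σ ϖ ((StdForm.antidiagonal 3).over K) γ (⟨stdLattice K 3, 0, isSelfDualLattice_stdLattice_three_of_v hϖ⟩ : {M : Submodule 𝒪[K] (Fin 3 → K) // IsVertex σ ϖ ((StdForm.antidiagonal 3).over K) M}) = ⟨stdLattice K 3, 0, isSelfDualLattice_stdLattice_three_of_v hϖ⟩ := latticeGraphIso_root_eq_of_mem_unitaryInt hϖ hγ0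
  have hr_lev : (⟨stdLattice K 3, 0, isSelfDualLattice_stdLattice_three_of_v hϖ⟩ : {M : Submodule 𝒪[K] (Fin 3 → K) // IsVertex σ ϖ ((StdForm.antidiagonal 3).over K) M}).1.map ((Matrix.toLin' (((γ : GL (Fin 3) K) : Matrix (Fin 3) (Fin 3) K) - 1)).restrictScalars 𝒪[K]) ≤ scaleLattice (ϖ ^ d₀) (⟨stdLattice K 3, 0, isSelfDualLattice_stdLattice_three_of_v hϖ⟩ : {M : Submodule 𝒪[K] (Fin 3 → K) // IsVertex σ ϖ ((StdForm.antidiagonal 3).over K) M}).1 := by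
    have h := (forall_v_conj_sub_one_le_iff_map_sub_one_le_scaleLattice γ (1 : unitaryGroupOfForm σ ((StdForm.antidiagonal 3).over K)) (pow_ne_zero d₀ hϖ0)).2 (fun i j => by
      rw [inv_one, one_mul, mul_one, map_pow]; exact hent i j)
    rw [OneMemClass.coe_one, mapGL_one] at h
    exact h
  -- ### 3. the region is the bare root (★ F0P3-p03 `eq_stdLattice_of_lev_of_anisotropic`)
  have hoff : ∀ w : {M : Submodule 𝒪[K] (Fin 3 → K) // IsVertex σ ϖ ((StdForm.antidiagonal 3).over K) M}, IsSelfDualLattice σ ϖ ((StdForm.antidiagonal 3).over K) w.1 → w ≠ ⟨stdLattice K 3, 0, isSelfDualLattice_stdLattice_three_of_v hϖ⟩ → ¬ (w.1.map ((Matrix.toLin' (((γ : GL (Fin 3) K) : Matrix (Fin 3) (Fin 3) K) - 1)).restrictScalars 𝒪[K]) ≤ scaleLattice (ϖ ^ d₀) w.1) :=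
    fun w hw hne hlev => hne (Subtype.ext (eq_stdLattice_of_lev_of_anisotropic hσ hvσ hϖ A hA hA' hd hdA s hγA i₀ he hiso hgap hj hk hjk haniso hw hlev))
  have hRiff : ∀ v : {M : Submodule 𝒪[K] (Fin 3 → K) // IsVertex σ ϖ ((StdForm.antidiagonal 3).over K) M}, v ∈ sR ↔ v = ⟨stdLattice K 3, 0, isSelfDualLattice_stdLattice_three_of_v hϖ⟩ := by
    intro v
    rw [hsR v, Set.mem_setOf_eq]
    constructor
    · rintro ⟨-, hSD, hlev⟩
      by_contra hne
      exact hoff v hSD hne hlev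
    · rintro rfl
      exact ⟨hr_fix, isSelfDualLattice_stdLattice_three_of_v hϖ, hr_lev⟩
  have hsR1 : sR = {⟨stdLattice K 3, 0, isSelfDualLattice_stdLattice_three_of_v hϖ⟩} := Finset.eq_singleton_iff_unique_mem.2 ⟨(hRiff _).2 rfl, fun v hv => (hRiff v).1 hv⟩
  -- ### 4. integrality of the line value; the non-square `ε`; the residue dichotomy; the class upgrade
  have hκcol : ∀ κ : unitaryGroupOfForm σ ((StdForm.antidiagonal 3).over K), κ ∈ unitaryInt σ ((StdForm.antidiagonal 3).over K) → ∀ i, Valued.v ((((κ : GL (Fin 3) K) : Matrix (Fin 3) (Fin 3) K) *ᵥ Pi.single 0 1) i) ≤ 1 := fun κ hκ i => by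
    rw [Matrix.mulVec_single_one]; exact (mem_unitaryInt_iff.1 hκ).1 i 0
  have hvalint : ∀ κ : unitaryGroupOfForm σ ((StdForm.antidiagonal 3).over K), κ ∈ unitaryInt σ ((StdForm.antidiagonal 3).over K) → ∃ t : 𝒪[K], (t : K) = ((ϖ ^ d₀)⁻¹ * pairing σ ((StdForm.antidiagonal 3).over K) (((κ : GL (Fin 3) K) : Matrix (Fin 3) (Fin 3) K) *ᵥ Pi.single 0 1) ((((γ : GL (Fin 3) K) : Matrix (Fin 3) (Fin 3) K) - 1) *ᵥ (((κ : GL (Fin 3) K) : Matrix (Fin 3) (Fin 3) K) *ᵥ Pi.single 0 1))) := fun κ hκ => by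
    obtain ⟨t, ht, -⟩ := exists_integer_eq_test_and_residue_eq hvσ hres hϖ0 (((γ : GL (Fin 3) K) : Matrix (Fin 3) (Fin 3) K) - 1) Y₀ hY₀ (fun i => ⟨(((κ : GL (Fin 3) K) : Matrix (Fin 3) (Fin 3) K) *ᵥ Pi.single 0 1) i, hκcol κ hκ i⟩)
    exact ⟨t, by rw [ht, pairing_antidiagonal]⟩
  have hc₁O : c₁ ∈ 𝒪[K] := (Valuation.mem_integer_iff _ _).2 hc₁.le
  have hεO : ε ∈ 𝒪[K] := (Valuation.mem_integer_iff _ _).2 hεv.le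
  have hc₁0 : (IsLocalRing.residue 𝒪[K] ⟨c₁, hc₁O⟩) ≠ 0 := by rw [Ne, hres0]; exact fun h => absurd hc₁ (ne_of_lt h)
  have hεns : ¬ IsSquare (IsLocalRing.residue 𝒪[K] ⟨ε, hεO⟩) := by
    rintro ⟨r, hr⟩
    obtain ⟨z, hz⟩ := IsLocalRing.residue_surjective r
    have h1 := hε (z : K) z.2
    have h0 : IsLocalRing.residue 𝒪[K] (z ^ 2 - ⟨ε, hεO⟩) = 0 := by rw [map_sub, map_pow, hz, hr]; ring
    rw [hres0] at h0
    exact absurd h1 (ne_of_lt h0)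
  have hdich : ∀ u c : K, Valued.v u = 1 → Valued.v c = 1 →
      (∃ b : K, Valued.v b = 1 ∧ Valued.v (u - c * b ^ 2) < 1) ∨ (∃ b : K, Valued.v b = 1 ∧ Valued.v (u - c * ε * b ^ 2) < 1) := by
    intro u c hu hc
    have huO : u ∈ 𝒪[K] := (Valuation.mem_integer_iff _ _).2 hu.le
    have hcO : c ∈ 𝒪[K] := (Valuation.mem_integer_iff _ _).2 hc.le
    have hcεO : c * ε ∈ 𝒪[K] := mul_mem hcO hεO
    have hu0 : IsLocalRing.residue 𝒪[K] ⟨u, huO⟩ ≠ 0 := by rw [Ne, hres0]; exact fun h => absurd hu (ne_of_lt h)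
    have hc0 : IsLocalRing.residue 𝒪[K] ⟨c, hcO⟩ ≠ 0 := by rw [Ne, hres0]; exact fun h => absurd hc (ne_of_lt h)
    have hε0 : IsLocalRing.residue 𝒪[K] ⟨ε, hεO⟩ ≠ 0 := by rw [Ne, hres0]; exact fun h => absurd hεv (ne_of_lt h)
    have hεχ : quadraticChar 𝓀[K] (IsLocalRing.residue 𝒪[K] ⟨ε, hεO⟩) = -1 := quadraticChar_neg_one_iff_not_isSquare.2 hεns
    have hcε : IsLocalRing.residue 𝒪[K] ⟨c * ε, hcεO⟩ = IsLocalRing.residue 𝒪[K] ⟨c, hcO⟩ * IsLocalRing.residue 𝒪[K] ⟨ε, hεO⟩ := by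
      rw [← map_mul]; rfl
    rcases quadraticChar_dichotomy (div_ne_zero hu0 hc0) with h1 | h1
    · left
      obtain ⟨r, hr⟩ := (quadraticChar_one_iff_isSquare (div_ne_zero hu0 hc0)).1 h1
      have hr0 : r ≠ 0 := fun h0 => by rw [h0, mul_zero] at hr; exact div_ne_zero hu0 hc0 hr
      refine (exists_unit_v_sub_mul_sq_lt_one_iff_residue ⟨u, huO⟩ ⟨c, hcO⟩).2 ⟨r, hr0, ?_⟩
      rw [pow_two, ← hr, mul_div_cancel₀ _ hc0]
    · right
      have hne0 : IsLocalRing.residue 𝒪[K] ⟨u, huO⟩ / IsLocalRing.residue 𝒪[K] ⟨c * ε, hcεO⟩ ≠ 0 := by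
        rw [hcε]; exact div_ne_zero hu0 (mul_ne_zero hc0 hε0)
      have hxe : quadraticChar 𝓀[K] (IsLocalRing.residue 𝒪[K] ⟨u, huO⟩ / IsLocalRing.residue 𝒪[K] ⟨c * ε, hcεO⟩) *
          quadraticChar 𝓀[K] (IsLocalRing.residue 𝒪[K] ⟨ε, hεO⟩) = quadraticChar 𝓀[K] (IsLocalRing.residue 𝒪[K] ⟨u, huO⟩ / IsLocalRing.residue 𝒪[K] ⟨c, hcO⟩) := by
        rw [← map_mul, hcε, ← div_div, div_mul_cancel₀ _ hε0]
      rw [hεχ, h1] at hxe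
      have h2' : quadraticChar 𝓀[K] (IsLocalRing.residue 𝒪[K] ⟨u, huO⟩ / IsLocalRing.residue 𝒪[K] ⟨c * ε, hcεO⟩) = 1 := by linarith
      obtain ⟨r, hr⟩ := (quadraticChar_one_iff_isSquare hne0).1 h2'
      have hr0 : r ≠ 0 := fun h0 => by rw [h0, mul_zero] at hr; exact hne0 hr
      refine (exists_unit_v_sub_mul_sq_lt_one_iff_residue ⟨u, huO⟩ ⟨c * ε, hcεO⟩).2 ⟨r, hr0, ?_⟩
      rw [pow_two, ← hr, mul_div_cancel₀ _ (by rw [hcε]; exact mul_ne_zero hc0 hε0)]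
  have hupg : ∀ (w : {M : Submodule 𝒪[K] (Fin 3 → K) // IsVertex σ ϖ ((StdForm.antidiagonal 3).over K) M}) (t c : K) (n : ℕ), (∃ b : K, Valued.v b = 1 ∧ Valued.v (-t - c * b ^ 2) < 1) →
      (∃ y ∈ w.1, ∃ a : K, Valued.v a = 1 ∧ Valued.v ((ϖ ^ n)⁻¹ * pairing σ ((StdForm.antidiagonal 3).over K) y ((((γ : GL (Fin 3) K) : Matrix (Fin 3) (Fin 3) K) - 1) *ᵥ y) - (-t) * a ^ 2) < 1) → (∃ y ∈ w.1, ∃ a : K, Valued.v a = 1 ∧ Valued.v ((ϖ ^ n)⁻¹ * pairing σ ((StdForm.antidiagonal 3).over K) y ((((γ : GL (Fin 3) K) : Matrix (Fin 3) (Fin 3) K) - 1) *ᵥ y) - c * a ^ 2) < 1) := by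
    rintro w t c n ⟨b, hb, hbt⟩ ⟨y', hy', a, ha, hya⟩
    refine ⟨y', hy', a * b, by rw [map_mul, ha, hb, mul_one], ?_⟩
    have hsplit : (ϖ ^ n)⁻¹ * pairing σ ((StdForm.antidiagonal 3).over K) y' ((((γ : GL (Fin 3) K) : Matrix (Fin 3) (Fin 3) K) - 1) *ᵥ y') - c * (a * b) ^ 2 =
        ((ϖ ^ n)⁻¹ * pairing σ ((StdForm.antidiagonal 3).over K) y' ((((γ : GL (Fin 3) K) : Matrix (Fin 3) (Fin 3) K) - 1) *ᵥ y') - (-t) * a ^ 2) + a ^ 2 * (-t - c * b ^ 2) := by ring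
    rw [hsplit]
    refine lt_of_le_of_lt (Valuation.map_add _ _ _) (max_lt hya ?_)
    rw [map_mul, map_pow, ha, one_pow, one_mul]
    exact hbt
  -- ### 5. the three slice predicates: `hPκ` by ★ S2 at `u = 1`, label exclusivity and ★ 1C
  have hPκE : ∀ κ : unitaryGroupOfForm σ ((StdForm.antidiagonal 3).over K), κ ∈ unitaryInt σ ((StdForm.antidiagonal 3).over K) → ∀ w : {M : Submodule 𝒪[K] (Fin 3 → K) // IsVertex σ ϖ ((StdForm.antidiagonal 3).over K) M}, IsSelfDualLattice σ ϖ ((StdForm.antidiagonal 3).over K) w.1 → latticeGraphIso σ ϖ ((StdForm.antidiagonal 3).over K) γ w = w → w ≠ ⟨stdLattice K 3, 0, isSelfDualLattice_stdLattice_three_of_v hϖ⟩ →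
      (latticeGraph σ ϖ ((StdForm.antidiagonal 3).over K)).Adj (latticeGraphIso σ ϖ ((StdForm.antidiagonal 3).over K) κ ⟨latt (Matrix.diagonal ![(1 : K), 1, ϖ]), 2, isVertexLattice_two_N₁_of_neg hσϖ hϖ⟩) w → ((¬ w.1.map ((Matrix.toLin' (((γ : GL (Fin 3) K) : Matrix (Fin 3) (Fin 3) K) - 1)).restrictScalars 𝒪[K]) ≤ scaleLattice (ϖ ^ d₀) w.1 ∧ (w.1.map ((Matrix.toLin' (((γ : GL (Fin 3) K) : Matrix (Fin 3) (Fin 3) K) - 1)).restrictScalars 𝒪[K]) ≤ scaleLattice (ϖ ^ (d₀ - 1)) w.1 ∧ ¬ w.1.map ((Matrix.toLin' (((γ : GL (Fin 3) K) : Matrix (Fin 3) (Fin 3) K) - 1)).restrictScalars 𝒪[K]) ≤ scaleLattice (ϖ ^ d₀) w.1)) ↔ Valued.v ((ϖ ^ d₀)⁻¹ * pairing σ ((StdForm.antidiagonal 3).over K) (((κ : GL (Fin 3) K) : Matrix (Fin 3) (Fin 3) K) *ᵥ Pi.single 0 1) ((((γ : GL (Fin 3) K) : Matrix (Fin 3)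 (Fin 3) K) - 1) *ᵥ (((κ : GL (Fin 3) K) : Matrix (Fin 3) (Fin 3) K) *ᵥ Pi.single 0 1))) < 1) := by
    intro κ hκ w hw hfw hne hadj
    have hS := offRegionGrandchildLabels hσ hvσ hσϖ hϖ hres h2 hT hγ0 hnorm d hd hdσ A hA hA' hdA s hs1 hsv hsσ hγA i₀ hd3 he hiso hclose
      (1 : unitaryGroupOfForm σ ((StdForm.antidiagonal 3).over K)) (v := ⟨stdLattice K 3, 0, isSelfDualLattice_stdLattice_three_of_v hϖ⟩) (latticeGraphIso_one_apply _).symm (isSelfDualLattice_stdLattice_three_of_v hϖ) hr_fix hr_lev κ hκ hw hfw hne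
      (by rw [one_mul]; exact hadj) (hoff w hw hne)
    simp only [inv_one, one_mul, mul_one] at hS
    obtain ⟨hnull, hunit⟩ := hS
    obtain ⟨t₀, ht₀⟩ := hvalint κ hκ
    constructor
    · rintro ⟨-, hlev1, -⟩
      by_contra hv
      have hv1 : Valued.v ((ϖ ^ d₀)⁻¹ * pairing σ ((StdForm.antidiagonal 3).over K) (((κ : GL (Fin 3) K) : Matrix (Fin 3) (Fin 3) K) *ᵥ Pi.single 0 1) ((((γ : GL (Fin 3) K) : Matrix (Fin 3) (Fin 3) K) - 1) *ᵥ (((κ : GL (Fin 3) K) : Matrix (Fin 3) (Fin 3) K) *ᵥ Pi.single 0 1))) = 1 := le_antisymm (by rw [← ht₀]; exact t₀.2) (not_lt.1 hv)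
      exact (hunit _ hv1 (by rw [sub_self, map_zero]; exact zero_lt_one)).2.1 hlev1
    · intro hv
      exact ⟨hoff w hw hne, (hnull hv).1, hoff w hw hne⟩
  have hPκP : ∀ κ : unitaryGroupOfForm σ ((StdForm.antidiagonal 3).over K), κ ∈ unitaryInt σ ((StdForm.antidiagonal 3).over K) → ∀ w : {M : Submodule 𝒪[K] (Fin 3 → K) // IsVertex σ ϖ ((StdForm.antidiagonal 3).over K) M}, IsSelfDualLattice σ ϖ ((StdForm.antidiagonal 3).over K) w.1 → latticeGraphIso σ ϖ ((StdForm.antidiagonal 3).over K) γ w = w → w ≠ ⟨stdLattice K 3, 0, isSelfDualLattice_stdLattice_three_of_v hϖ⟩ →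
      (latticeGraph σ ϖ ((StdForm.antidiagonal 3).over K)).Adj (latticeGraphIso σ ϖ ((StdForm.antidiagonal 3).over K) κ ⟨latt (Matrix.diagonal ![(1 : K), 1, ϖ]), 2, isVertexLattice_two_N₁_of_neg hσϖ hϖ⟩) w → ((¬ w.1.map ((Matrix.toLin' (((γ : GL (Fin 3) K) : Matrix (Fin 3) (Fin 3) K) - 1)).restrictScalars 𝒪[K]) ≤ scaleLattice (ϖ ^ d₀) w.1 ∧ (w.1.map ((Matrix.toLin' (((γ : GL (Fin 3) K) : Matrix (Fin 3) (Fin 3) K) - 1)).restrictScalars 𝒪[K]) ≤ scaleLattice (ϖ ^ (d₀ - 2)) w.1 ∧ ¬ w.1.map ((Matrix.toLin' (((γ : GL (Fin 3) K) : Matrix (Fin 3) (Fin 3) K) - 1)).restrictScalars 𝒪[K]) ≤ scaleLattice (ϖ ^ (d₀ - 1)) w.1) ∧ ∃ y ∈ w.1, ∃ a : K, Valued.v a = 1 ∧ Valued.v ((ϖ ^ (d₀ - 2))⁻¹ * pairing σ ((StdForm.antidiagonal 3).over K) y ((((γ : GL (Fin 3) K) : Matrix (Fin 3) (Fin 3)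 K) - 1) *ᵥ y) - (c₁) * a ^ 2) < 1) ↔ (∃ b : K, Valued.v b = 1 ∧ Valued.v (((ϖ ^ d₀)⁻¹ * pairing σ ((StdForm.antidiagonal 3).over K) (((κ : GL (Fin 3) K) : Matrix (Fin 3) (Fin 3) K) *ᵥ Pi.single 0 1) ((((γ : GL (Fin 3) K) : Matrix (Fin 3) (Fin 3) K) - 1) *ᵥ (((κ : GL (Fin 3) K) : Matrix (Fin 3) (Fin 3) K) *ᵥ Pi.single 0 1))) + c₁ * b ^ 2) < 1)) := by
    intro κ hκ w hw hfw hne hadj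
    have hS := offRegionGrandchildLabels hσ hvσ hσϖ hϖ hres h2 hT hγ0 hnorm d hd hdσ A hA hA' hdA s hs1 hsv hsσ hγA i₀ hd3 he hiso hclose
      (1 : unitaryGroupOfForm σ ((StdForm.antidiagonal 3).over K)) (v := ⟨stdLattice K 3, 0, isSelfDualLattice_stdLattice_three_of_v hϖ⟩) (latticeGraphIso_one_apply _).symm (isSelfDualLattice_stdLattice_three_of_v hϖ) hr_fix hr_lev κ hκ hw hfw hne
      (by rw [one_mul]; exact hadj) (hoff w hw hne)
    simp only [inv_one, one_mul, mul_one] at hS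
    obtain ⟨hnull, hunit⟩ := hS
    obtain ⟨t₀, ht₀⟩ := hvalint κ hκ
    have hvle : Valued.v ((ϖ ^ d₀)⁻¹ * pairing σ ((StdForm.antidiagonal 3).over K) (((κ : GL (Fin 3) K) : Matrix (Fin 3) (Fin 3) K) *ᵥ Pi.single 0 1) ((((γ : GL (Fin 3) K) : Matrix (Fin 3) (Fin 3) K) - 1) *ᵥ (((κ : GL (Fin 3) K) : Matrix (Fin 3) (Fin 3) K) *ᵥ Pi.single 0 1))) ≤ 1 := by rw [← ht₀]; exact t₀.2
    constructor
    · rintro ⟨-, ⟨-, hnlev1⟩, hcls⟩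
      have hv1 : Valued.v ((ϖ ^ d₀)⁻¹ * pairing σ ((StdForm.antidiagonal 3).over K) (((κ : GL (Fin 3) K) : Matrix (Fin 3) (Fin 3) K) *ᵥ Pi.single 0 1) ((((γ : GL (Fin 3) K) : Matrix (Fin 3) (Fin 3) K) - 1) *ᵥ (((κ : GL (Fin 3) K) : Matrix (Fin 3) (Fin 3) K) *ᵥ Pi.single 0 1))) = 1 := le_antisymm hvle (not_lt.1 fun hv => hnlev1 (hnull hv).1)
      obtain ⟨hlev2, hnlev1', hsq, hclsneg⟩ := hunit _ hv1 (by rw [sub_self, map_zero]; exact zero_lt_one)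
      rcases hdich (-((ϖ ^ d₀)⁻¹ * pairing σ ((StdForm.antidiagonal 3).over K) (((κ : GL (Fin 3) K) : Matrix (Fin 3) (Fin 3) K) *ᵥ Pi.single 0 1) ((((γ : GL (Fin 3) K) : Matrix (Fin 3) (Fin 3) K) - 1) *ᵥ (((κ : GL (Fin 3) K) : Matrix (Fin 3) (Fin 3) K) *ᵥ Pi.single 0 1)))) c₁ (by rw [Valuation.map_neg, hv1]) hc₁ with ⟨b, hb, hbv⟩ | ⟨b, hb, hbv⟩
      · exact ⟨b, hb, by rw [show ((ϖ ^ d₀)⁻¹ * pairing σ ((StdForm.antidiagonal 3).over K) (((κ : GL (Fin 3) K) : Matrix (Fin 3) (Fin 3) K) *ᵥ Pi.single 0 1) ((((γ : GL (Fin 3) K) : Matrix (Fin 3) (Fin 3) K) - 1) *ᵥ (((κ : GL (Fin 3) K) : Matrix (Fin 3) (Fin 3) K) *ᵥ Pi.single 0 1))) + c₁ * b ^ 2 = -(-((ϖ ^ d₀)⁻¹ * pairing σ ((StdForm.antidiagonal 3).over K) (((κ : GL (Fin 3) K) : Matrix (Fin 3) (Fin 3) K) *ᵥ Pi.single 0 1)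 ((((γ : GL (Fin 3) K) : Matrix (Fin 3) (Fin 3) K) - 1) *ᵥ (((κ : GL (Fin 3) K) : Matrix (Fin 3) (Fin 3) K) *ᵥ Pi.single 0 1))) - c₁ * b ^ 2) by ring, Valuation.map_neg]; exact hbv⟩
      · exfalso
        have hclsε := hupg w ((ϖ ^ d₀)⁻¹ * pairing σ ((StdForm.antidiagonal 3).over K) (((κ : GL (Fin 3) K) : Matrix (Fin 3) (Fin 3) K) *ᵥ Pi.single 0 1) ((((γ : GL (Fin 3) K) : Matrix (Fin 3) (Fin 3) K) - 1) *ᵥ (((κ : GL (Fin 3) K) : Matrix (Fin 3) (Fin 3) K) *ᵥ Pi.single 0 1))) (c₁ * ε) (d₀ - 2) ⟨b, hb, hbv⟩ hclsneg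
        have h1C := class_xor_class_mul_of_selfDual_rankOne hσ hvσ hσϖ hϖ hres h2 γ hw hd1 hlev2
          (by rw [show d₀ - 2 + 1 = d₀ - 1 by omega]; exact hnlev1')
          (by rw [show 2 * (d₀ - 2) + 1 = 2 * d₀ - 3 by omega]; exact hsq) c₁ ε hc₁ hεv hε
        exact h1C.2 ⟨hcls, hclsε⟩
    · rintro ⟨b, hb, hbv⟩
      have hv1 : Valued.v ((ϖ ^ d₀)⁻¹ * pairing σ ((StdForm.antidiagonal 3).over K) (((κ : GL (Fin 3) K) : Matrix (Fin 3) (Fin 3) K) *ᵥ Pi.single 0 1) ((((γ : GL (Fin 3) K) : Matrix (Fin 3) (Fin 3) K) - 1) *ᵥ (((κ : GL (Fin 3) K) : Matrix (Fin 3) (Fin 3) K) *ᵥ Pi.single 0 1))) = 1 := by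
        by_contra hne1
        have hlt : Valued.v ((ϖ ^ d₀)⁻¹ * pairing σ ((StdForm.antidiagonal 3).over K) (((κ : GL (Fin 3) K) : Matrix (Fin 3) (Fin 3) K) *ᵥ Pi.single 0 1) ((((γ : GL (Fin 3) K) : Matrix (Fin 3) (Fin 3) K) - 1) *ᵥ (((κ : GL (Fin 3) K) : Matrix (Fin 3) (Fin 3) K) *ᵥ Pi.single 0 1))) < 1 := lt_of_le_of_ne hvle hne1
        have hcb : Valued.v (c₁ * b ^ 2) = 1 := by rw [map_mul, map_pow, hc₁, hb, one_pow, mul_one]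
        have h := Valuation.map_sub Valued.v (((ϖ ^ d₀)⁻¹ * pairing σ ((StdForm.antidiagonal 3).over K) (((κ : GL (Fin 3) K) : Matrix (Fin 3) (Fin 3) K) *ᵥ Pi.single 0 1) ((((γ : GL (Fin 3) K) : Matrix (Fin 3) (Fin 3) K) - 1) *ᵥ (((κ : GL (Fin 3) K) : Matrix (Fin 3) (Fin 3) K) *ᵥ Pi.single 0 1))) + c₁ * b ^ 2) ((ϖ ^ d₀)⁻¹ * pairing σ ((StdForm.antidiagonal 3).over K) (((κ : GL (Fin 3) K) : Matrix (Fin 3) (Fin 3) K) *ᵥ Pi.single 0 1) ((((γ : GL (Fin 3) K) : Matrix (Fin 3) (Fin 3) K) - 1) *ᵥ (((κ : GL (Fin 3) K) : Matrix (Fin 3) (Fin 3) K) *ᵥ Pi.single 0 1)))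
        rw [show ((ϖ ^ d₀)⁻¹ * pairing σ ((StdForm.antidiagonal 3).over K) (((κ : GL (Fin 3) K) : Matrix (Fin 3) (Fin 3) K) *ᵥ Pi.single 0 1) ((((γ : GL (Fin 3) K) : Matrix (Fin 3) (Fin 3) K) - 1) *ᵥ (((κ : GL (Fin 3) K) : Matrix (Fin 3) (Fin 3) K) *ᵥ Pi.single 0 1))) + c₁ * b ^ 2 - ((ϖ ^ d₀)⁻¹ * pairing σ ((StdForm.antidiagonal 3).over K) (((κ : GL (Fin 3) K) : Matrix (Fin 3) (Fin 3) K) *ᵥ Pi.single 0 1) ((((γ : GL (Fin 3) K) : Matrix (Fin 3) (Fin 3) K) - 1) *ᵥ (((κ : GL (Fin 3) K) : Matrix (Fin 3) (Fin 3) K) *ᵥ Pi.single 0 1))) = c₁ * b ^ 2 by ring, hcb] at h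
        exact absurd h (not_le.2 (max_lt hbv hlt))
      obtain ⟨hlev2, hnlev1', -, hclsneg⟩ := hunit _ hv1 (by rw [sub_self, map_zero]; exact zero_lt_one)
      refine ⟨hoff w hw hne, ⟨hlev2, hnlev1'⟩, ?_⟩
      exact hupg w ((ϖ ^ d₀)⁻¹ * pairing σ ((StdForm.antidiagonal 3).over K) (((κ : GL (Fin 3) K) : Matrix (Fin 3) (Fin 3) K) *ᵥ Pi.single 0 1) ((((γ : GL (Fin 3) K) : Matrix (Fin 3) (Fin 3) K) - 1) *ᵥ (((κ : GL (Fin 3) K) : Matrix (Fin 3) (Fin 3) K) *ᵥ Pi.single 0 1))) c₁ (d₀ - 2) ⟨b, hb, by rw [show -((ϖ ^ d₀)⁻¹ * pairing σ ((StdForm.antidiagonal 3).over K) (((κ : GL (Fin 3) K) : Matrix (Fin 3) (Fin 3) K) *ᵥ Pi.single 0 1) ((((γ : GL (Fin 3) K) : Matrix (Fin 3) (Fin 3) K) - 1) *ᵥ (((κ : GL (Fin 3) K) : Matrix (Fin 3) (Fin 3) K) *ᵥ Pi.single 0 1))) - c₁ * b ^ 2 = -(((ϖ ^ d₀)⁻¹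 * pairing σ ((StdForm.antidiagonal 3).over K) (((κ : GL (Fin 3) K) : Matrix (Fin 3) (Fin 3) K) *ᵥ Pi.single 0 1) ((((γ : GL (Fin 3) K) : Matrix (Fin 3) (Fin 3) K) - 1) *ᵥ (((κ : GL (Fin 3) K) : Matrix (Fin 3) (Fin 3) K) *ᵥ Pi.single 0 1))) + c₁ * b ^ 2) by ring, Valuation.map_neg]; exact hbv⟩ hclsneg
  have hPκM : ∀ κ : unitaryGroupOfForm σ ((StdForm.antidiagonal 3).over K), κ ∈ unitaryInt σ ((StdForm.antidiagonal 3).over K) → ∀ w : {M : Submodule 𝒪[K] (Fin 3 → K) // IsVertex σ ϖ ((StdForm.antidiagonal 3).over K) M}, IsSelfDualLattice σ ϖ ((StdForm.antidiagonal 3).over K) w.1 → latticeGraphIso σ ϖ ((StdForm.antidiagonal 3).over K) γ w = w → w ≠ ⟨stdLattice K 3, 0, isSelfDualLattice_stdLattice_three_of_v hϖ⟩ →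
      (latticeGraph σ ϖ ((StdForm.antidiagonal 3).over K)).Adj (latticeGraphIso σ ϖ ((StdForm.antidiagonal 3).over K) κ ⟨latt (Matrix.diagonal ![(1 : K), 1, ϖ]), 2, isVertexLattice_two_N₁_of_neg hσϖ hϖ⟩) w → ((¬ w.1.map ((Matrix.toLin' (((γ : GL (Fin 3) K) : Matrix (Fin 3) (Fin 3) K) - 1)).restrictScalars 𝒪[K]) ≤ scaleLattice (ϖ ^ d₀) w.1 ∧ (w.1.map ((Matrix.toLin' (((γ : GL (Fin 3) K) : Matrix (Fin 3) (Fin 3) K) - 1)).restrictScalars 𝒪[K]) ≤ scaleLattice (ϖ ^ (d₀ - 2)) w.1 ∧ ¬ w.1.map ((Matrix.toLin' (((γ : GL (Fin 3) K) : Matrix (Fin 3) (Fin 3) K) - 1)).restrictScalars 𝒪[K]) ≤ scaleLattice (ϖ ^ (d₀ - 1)) w.1) ∧ ¬ (∃ y ∈ w.1, ∃ a : K, Valued.v a = 1 ∧ Valued.v ((ϖ ^ (d₀ - 2))⁻¹ * pairing σ ((StdForm.antidiagonal 3).over K) y ((((γ : GL (Fin 3) K) : Matrix (Fin 3) (Fin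 3) K) - 1) *ᵥ y) - (c₁) * a ^ 2) < 1)) ↔ (Valued.v ((ϖ ^ d₀)⁻¹ * pairing σ ((StdForm.antidiagonal 3).over K) (((κ : GL (Fin 3) K) : Matrix (Fin 3) (Fin 3) K) *ᵥ Pi.single 0 1) ((((γ : GL (Fin 3) K) : Matrix (Fin 3) (Fin 3) K) - 1) *ᵥ (((κ : GL (Fin 3) K) : Matrix (Fin 3) (Fin 3) K) *ᵥ Pi.single 0 1))) = 1 ∧ ¬ ∃ b : K, Valued.v b = 1 ∧ Valued.v (((ϖ ^ d₀)⁻¹ * pairing σ ((StdForm.antidiagonal 3).over K) (((κ : GL (Fin 3) K) : Matrix (Fin 3) (Fin 3) K) *ᵥ Pi.single 0 1) ((((γ : GL (Fin 3) K) : Matrix (Fin 3) (Fin 3) K) - 1) *ᵥ (((κ : GL (Fin 3) K) : Matrix (Fin 3) (Fin 3) K) *ᵥ Pi.single 0 1))) + c₁ * b ^ 2) < 1)) := by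
    intro κ hκ w hw hfw hne hadj
    have hS := offRegionGrandchildLabels hσ hvσ hσϖ hϖ hres h2 hT hγ0 hnorm d hd hdσ A hA hA' hdA s hs1 hsv hsσ hγA i₀ hd3 he hiso hclose
      (1 : unitaryGroupOfForm σ ((StdForm.antidiagonal 3).over K)) (v := ⟨stdLattice K 3, 0, isSelfDualLattice_stdLattice_three_of_v hϖ⟩) (latticeGraphIso_one_apply _).symm (isSelfDualLattice_stdLattice_three_of_v hϖ) hr_fix hr_lev κ hκ hw hfw hne
      (by rw [one_mul]; exact hadj) (hoff w hw hne)
    simp only [inv_one, one_mul, mul_one] at hS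
    obtain ⟨hnull, hunit⟩ := hS
    obtain ⟨t₀, ht₀⟩ := hvalint κ hκ
    have hvle : Valued.v ((ϖ ^ d₀)⁻¹ * pairing σ ((StdForm.antidiagonal 3).over K) (((κ : GL (Fin 3) K) : Matrix (Fin 3) (Fin 3) K) *ᵥ Pi.single 0 1) ((((γ : GL (Fin 3) K) : Matrix (Fin 3) (Fin 3) K) - 1) *ᵥ (((κ : GL (Fin 3) K) : Matrix (Fin 3) (Fin 3) K) *ᵥ Pi.single 0 1))) ≤ 1 := by rw [← ht₀]; exact t₀.2
    constructor
    · rintro ⟨-, ⟨-, hnlev1⟩, hncls⟩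
      have hv1 : Valued.v ((ϖ ^ d₀)⁻¹ * pairing σ ((StdForm.antidiagonal 3).over K) (((κ : GL (Fin 3) K) : Matrix (Fin 3) (Fin 3) K) *ᵥ Pi.single 0 1) ((((γ : GL (Fin 3) K) : Matrix (Fin 3) (Fin 3) K) - 1) *ᵥ (((κ : GL (Fin 3) K) : Matrix (Fin 3) (Fin 3) K) *ᵥ Pi.single 0 1))) = 1 := le_antisymm hvle (not_lt.1 fun hv => hnlev1 (hnull hv).1)
      obtain ⟨-, -, -, hclsneg⟩ := hunit _ hv1 (by rw [sub_self, map_zero]; exact zero_lt_one)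
      refine ⟨hv1, ?_⟩
      rintro ⟨b, hb, hbv⟩
      exact hncls (hupg w ((ϖ ^ d₀)⁻¹ * pairing σ ((StdForm.antidiagonal 3).over K) (((κ : GL (Fin 3) K) : Matrix (Fin 3) (Fin 3) K) *ᵥ Pi.single 0 1) ((((γ : GL (Fin 3) K) : Matrix (Fin 3) (Fin 3) K) - 1) *ᵥ (((κ : GL (Fin 3) K) : Matrix (Fin 3) (Fin 3) K) *ᵥ Pi.single 0 1))) c₁ (d₀ - 2) ⟨b, hb, by rw [show -((ϖ ^ d₀)⁻¹ * pairing σ ((StdForm.antidiagonal 3).over K) (((κ : GL (Fin 3) K) : Matrix (Fin 3) (Fin 3) K) *ᵥ Pi.single 0 1) ((((γ : GL (Fin 3) K) : Matrix (Fin 3) (Fin 3) K) - 1) *ᵥ (((κ : GL (Fin 3) K) : Matrix (Fin 3) (Fin 3) K) *ᵥ Pi.single 0 1))) - c₁ * b ^ 2 = -(((ϖ ^ d₀)⁻¹ * pairing σ ((StdForm.antidiagonal 3).over K) (((κ : GL (Fin 3) K) : Matrix (Fin 3) (Fin 3) K) *ᵥ Pi.single 0 1) ((((γ : GL (Fin 3)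 K) : Matrix (Fin 3) (Fin 3) K) - 1) *ᵥ (((κ : GL (Fin 3) K) : Matrix (Fin 3) (Fin 3) K) *ᵥ Pi.single 0 1))) + c₁ * b ^ 2) by ring, Valuation.map_neg]; exact hbv⟩ hclsneg)
    · rintro ⟨hv1, hno⟩
      obtain ⟨hlev2, hnlev1', hsq, hclsneg⟩ := hunit _ hv1 (by rw [sub_self, map_zero]; exact zero_lt_one)
      refine ⟨hoff w hw hne, ⟨hlev2, hnlev1'⟩, fun hcls => ?_⟩
      rcases hdich (-((ϖ ^ d₀)⁻¹ * pairing σ ((StdForm.antidiagonal 3).over K) (((κ : GL (Fin 3) K) : Matrix (Fin 3) (Fin 3) K) *ᵥ Pi.single 0 1) ((((γ : GL (Fin 3) K) : Matrix (Fin 3) (Fin 3) K) - 1) *ᵥ (((κ : GL (Fin 3) K) : Matrix (Fin 3) (Fin 3) K) *ᵥ Pi.single 0 1)))) c₁ (by rw [Valuation.map_neg, hv1]) hc₁ with ⟨b, hb, hbv⟩ | ⟨b, hb, hbv⟩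
      · exact hno ⟨b, hb, by rw [show ((ϖ ^ d₀)⁻¹ * pairing σ ((StdForm.antidiagonal 3).over K) (((κ : GL (Fin 3) K) : Matrix (Fin 3) (Fin 3) K) *ᵥ Pi.single 0 1) ((((γ : GL (Fin 3) K) : Matrix (Fin 3) (Fin 3) K) - 1) *ᵥ (((κ : GL (Fin 3) K) : Matrix (Fin 3) (Fin 3) K) *ᵥ Pi.single 0 1))) + c₁ * b ^ 2 = -(-((ϖ ^ d₀)⁻¹ * pairing σ ((StdForm.antidiagonal 3).over K) (((κ : GL (Fin 3) K) : Matrix (Fin 3) (Fin 3) K) *ᵥ Pi.single 0 1) ((((γ : GL (Fin 3) K) : Matrix (Fin 3) (Fin 3) K) - 1) *ᵥ (((κ : GL (Fin 3) K) : Matrix (Fin 3) (Fin 3) K) *ᵥ Pi.single 0 1))) - c₁ * b ^ 2) by ring, Valuation.map_neg]; exact hbv⟩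
      · have hclsε := hupg w ((ϖ ^ d₀)⁻¹ * pairing σ ((StdForm.antidiagonal 3).over K) (((κ : GL (Fin 3) K) : Matrix (Fin 3) (Fin 3) K) *ᵥ Pi.single 0 1) ((((γ : GL (Fin 3) K) : Matrix (Fin 3) (Fin 3) K) - 1) *ᵥ (((κ : GL (Fin 3) K) : Matrix (Fin 3) (Fin 3) K) *ᵥ Pi.single 0 1))) (c₁ * ε) (d₀ - 2) ⟨b, hb, hbv⟩ hclsneg
        have h1C := class_xor_class_mul_of_selfDual_rankOne hσ hvσ hσϖ hϖ hres h2 γ hw hd1 hlev2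
          (by rw [show d₀ - 2 + 1 = d₀ - 1 by omega]; exact hnlev1')
          (by rw [show 2 * (d₀ - 2) + 1 = 2 * d₀ - 3 by omega]; exact hsq) c₁ ε hc₁ hεv hε
        exact h1C.2 ⟨hcls, hclsε⟩
  -- ### 6. the keyed children sets are the ★ bridge's sets; the root census evaluates them
  have hkey : ∀ (Pκ : unitaryGroupOfForm σ ((StdForm.antidiagonal 3).over K) → Prop) (P' : 𝓀[K] → Prop), (∀ κ : unitaryGroupOfForm σ ((StdForm.antidiagonal 3).over K), κ ∈ unitaryInt σ ((StdForm.antidiagonal 3).over K) → ∀ t : 𝒪[K], (t : K) = ((ϖ ^ d₀)⁻¹ * pairing σ ((StdForm.antidiagonal 3).over K) (((κ : GL (Fin 3) K) : Matrix (Fin 3) (Fin 3) K) *ᵥ Pi.single 0 1) ((((γ : GL (Fin 3) K) : Matrix (Fin 3) (Fin 3) K) - 1) *ᵥ (((κ : GL (Fin 3) K) : Matrix (Fin 3) (Fin 3) K) *ᵥ Pi.single 0 1))) → (Pκ κ ↔ P' (IsLocalRing.residue 𝒪[K] t))) →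
      {c : {M : Submodule 𝒪[K] (Fin 3 → K) // IsVertex σ ϖ ((StdForm.antidiagonal 3).over K) M} | (latticeGraph σ ϖ ((StdForm.antidiagonal 3).over K)).Adj ⟨stdLattice K 3, 0, isSelfDualLattice_stdLattice_three_of_v hϖ⟩ c ∧ ∃ κ : unitaryGroupOfForm σ ((StdForm.antidiagonal 3).over K), κ ∈ unitaryInt σ ((StdForm.antidiagonal 3).over K) ∧ c = latticeGraphIso σ ϖ ((StdForm.antidiagonal 3).over K) κ ⟨latt (Matrix.diagonal ![(1 : K), 1, ϖ]), 2, isVertexLattice_two_N₁_of_neg hσϖ hϖ⟩ ∧ Pκ κ} = {w : {M : Submodule 𝒪[K] (Fin 3 → K) // IsVertex σ ϖ ((StdForm.antidiagonal 3).over K) M} | w ∈ (latticeGraph σ ϖ ((StdForm.antidiagonal 3).over K)).neighborSet ⟨stdLattice K 3, 0, isSelfDualLattice_stdLattice_three_of_v hϖ⟩ ∧ ∃ κ : unitaryGroupOfForm σ ((StdForm.antidiagonal 3).over K), κ ∈ unitaryInt σ ((StdForm.antidiagonal 3).over K) ∧ w.1 = mapGL (κ : GL (Fin 3) K) (latt (Matrix.diagonal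 ![(1 : K), 1, ϖ])) ∧ ∃ t : 𝒪[K], (t : K) = (ϖ ^ d₀)⁻¹ * B₀ σ 3 (((κ : GL (Fin 3) K) : Matrix (Fin 3) (Fin 3) K) *ᵥ Pi.single 0 1) ((((γ : GL (Fin 3) K) : Matrix (Fin 3) (Fin 3) K) - 1) *ᵥ (((κ : GL (Fin 3) K) : Matrix (Fin 3) (Fin 3) K) *ᵥ Pi.single 0 1)) ∧ P' (IsLocalRing.residue 𝒪[K] t)} := by
    intro Pκ P' hiff
    have hB₀ : ∀ κ : unitaryGroupOfForm σ ((StdForm.antidiagonal 3).over K), (ϖ ^ d₀)⁻¹ * B₀ σ 3 (((κ : GL (Fin 3) K) : Matrix (Fin 3) (Fin 3) K) *ᵥ Pi.single 0 1) ((((γ : GL (Fin 3) K) : Matrix (Fin 3) (Fin 3) K) - 1) *ᵥ (((κ : GL (Fin 3) K) : Matrix (Fin 3) (Fin 3) K) *ᵥ Pi.single 0 1)) = ((ϖ ^ d₀)⁻¹ * pairing σ ((StdForm.antidiagonal 3).over K) (((κ : GL (Fin 3) K) : Matrix (Fin 3) (Fin 3) K) *ᵥ Pi.single 0 1) ((((γ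 : GL (Fin 3) K) : Matrix (Fin 3) (Fin 3) K) - 1) *ᵥ (((κ : GL (Fin 3) K) : Matrix (Fin 3) (Fin 3) K) *ᵥ Pi.single 0 1))) := fun κ => by
      rw [pairing_antidiagonal]
    have hN₁ : ∀ κ : unitaryGroupOfForm σ ((StdForm.antidiagonal 3).over K),
        (latticeGraphIso σ ϖ ((StdForm.antidiagonal 3).over K) κ ⟨latt (Matrix.diagonal ![(1 : K), 1, ϖ]), 2, isVertexLattice_two_N₁_of_neg hσϖ hϖ⟩).1 =
          mapGL (κ : GL (Fin 3) K) (latt (Matrix.diagonal ![(1 : K), 1, ϖ])) := fun κ => rfl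
    apply Set.Subset.antisymm
    · intro c hc'
      rw [Set.mem_setOf_eq] at hc'
      obtain ⟨hadj, κ, hκ, hc, hP⟩ := hc'
      obtain ⟨t, ht⟩ := hvalint κ hκ
      rw [Set.mem_setOf_eq, SimpleGraph.mem_neighborSet]
      refine ⟨hadj, κ, hκ, ?_, t, ?_, (hiff κ hκ t ht).1 hP⟩
      · rw [hc]; exact hN₁ κ
      · rw [hB₀ κ]; exact ht
    · intro c hc'
      obtain ⟨hadj, κ, hκ, hc, t, ht, hP⟩ := hc'
      rw [hB₀ κ] at ht
      rw [Set.mem_setOf_eq]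
      refine ⟨(SimpleGraph.mem_neighborSet _ _ _).1 hadj, κ, hκ, Subtype.ext ?_, (hiff κ hκ t ht).2 hP⟩
      rw [hN₁ κ]; exact hc
  -- E: null values — none
  have hNE : ({c : {M : Submodule 𝒪[K] (Fin 3 → K) // IsVertex σ ϖ ((StdForm.antidiagonal 3).over K) M} | (latticeGraph σ ϖ ((StdForm.antidiagonal 3).over K)).Adj ⟨stdLattice K 3, 0, isSelfDualLattice_stdLattice_three_of_v hϖ⟩ c ∧ ∃ κ : unitaryGroupOfForm σ ((StdForm.antidiagonal 3).over K), κ ∈ unitaryInt σ ((StdForm.antidiagonal 3).over K) ∧ c = latticeGraphIso σ ϖ ((StdForm.antidiagonal 3).over K) κ ⟨latt (Matrix.diagonal ![(1 : K), 1, ϖ]), 2, isVertexLattice_two_N₁_of_neg hσϖ hϖ⟩ ∧ Valued.v ((ϖ ^ d₀)⁻¹ * pairing σ ((StdForm.antidiagonal 3).over K) (((κ : GL (Fin 3) K) : Matrix (Fin 3) (Fin 3) K) *ᵥ Pi.single 0 1) ((((γ : GL (Fin 3) K) : Matrix (Fin 3) (Fin 3) K) - 1) *ᵥ (((κ : GL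 (Fin 3) K) : Matrix (Fin 3) (Fin 3) K) *ᵥ Pi.single 0 1))) < 1}).ncard = 0 := by
    have hk' := hkey (fun κ : unitaryGroupOfForm σ ((StdForm.antidiagonal 3).over K) => Valued.v ((ϖ ^ d₀)⁻¹ * pairing σ ((StdForm.antidiagonal 3).over K) (((κ : GL (Fin 3) K) : Matrix (Fin 3) (Fin 3) K) *ᵥ Pi.single 0 1) ((((γ : GL (Fin 3) K) : Matrix (Fin 3) (Fin 3) K) - 1) *ᵥ (((κ : GL (Fin 3) K) : Matrix (Fin 3) (Fin 3) K) *ᵥ Pi.single 0 1))) < 1) (fun t => t = 0) (fun κ hκ t ht => by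
      show Valued.v ((ϖ ^ d₀)⁻¹ * pairing σ ((StdForm.antidiagonal 3).over K) (((κ : GL (Fin 3) K) : Matrix (Fin 3) (Fin 3) K) *ᵥ Pi.single 0 1) ((((γ : GL (Fin 3) K) : Matrix (Fin 3) (Fin 3) K) - 1) *ᵥ (((κ : GL (Fin 3) K) : Matrix (Fin 3) (Fin 3) K) *ᵥ Pi.single 0 1))) < 1 ↔ IsLocalRing.residue 𝒪[K] t = 0
      rw [hres0, ht])
    beta_reduce at hk'
    rw [hk', ncard_neighborSet_root_pred_eq_natCard hσ hvσ hσϖ hϖ hres h2 (d := d₀) (((γ : GL (Fin 3) K) : Matrix (Fin 3) (Fin 3) K) - 1) Y₀ hY₀ (fun t => t = 0) (fun c t hc => by simp [hc])]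
    have h := natCard_params_rootFrame_pred_eq hk2 (Ne.symm hj) (Ne.symm hk) hjk δ hδ0 y (hyeq j k hj hk) Ab (Y₀.map (IsLocalRing.residue 𝒪[K])) hG hY
      (fun t => t = 0) (fun c t hc => by simp [hc])
    simp only [if_true, hχ, if_neg hCne] at h
    have h' : ((Nat.card {p : Option {p : 𝓀[K] × 𝓀[K] // p.2 + (RingHom.id 𝓀[K]) p.2 + p.1 * (RingHom.id 𝓀[K]) p.1 = 0} //
        (p.elim (Pi.single 2 1) fun q => ![(1 : 𝓀[K]), q.1.1, q.1.2]) ⬝ᵥ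
          ((((StdForm.antidiagonal 3).over 𝓀[K]) * Y₀.map (IsLocalRing.residue 𝒪[K])) *ᵥ (p.elim (Pi.single 2 1) fun q => ![(1 : 𝓀[K]), q.1.1, q.1.2])) = 0} : ℕ) : ℤ) = 0 := by
      rw [h]; ring
    exact_mod_cast h'
  -- the `K`-level class constant `C` reduces to the census class `(y i₀ − y j)·δ i₀`
  have htO : ∀ m, (ϖ ^ d₀)⁻¹ * (s m - 1) ∈ 𝒪[K] := fun m => by
    refine (Valuation.mem_integer_iff _ _).2 ?_
    rw [map_mul, map_inv₀, map_pow]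
    have h' := mul_le_mul' (le_refl ((Valued.v ϖ ^ d₀)⁻¹)) (he m)
    rwa [inv_mul_cancel₀ (pow_ne_zero _ hvϖ0)] at h'
  have hcdet : Valued.v (-(Matrix.diagonal d).det) = 1 := by
    rw [Valuation.map_neg, Matrix.det_diagonal, map_prod]; exact Finset.prod_eq_one fun i _ => hd i
  have hdcO : d i₀ * (-(Matrix.diagonal d).det)⁻¹ ∈ 𝒪[K] := by
    refine (Valuation.mem_integer_iff _ _).2 ?_
    rw [map_mul, map_inv₀, hd, hcdet, inv_one, mul_one]
  have hCO : ((ϖ ^ d₀)⁻¹ * (s i₀ - s j) * (d i₀ * (-(Matrix.diagonal d).det)⁻¹)) ∈ 𝒪[K] := by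
    have h : ((ϖ ^ d₀)⁻¹ * (s i₀ - s j) * (d i₀ * (-(Matrix.diagonal d).det)⁻¹)) = ((ϖ ^ d₀)⁻¹ * (s i₀ - 1) - (ϖ ^ d₀)⁻¹ * (s j - 1)) * (d i₀ * (-(Matrix.diagonal d).det)⁻¹) := by ring
    rw [h]; exact mul_mem (sub_mem (htO i₀) (htO j)) hdcO
  have hCres : IsLocalRing.residue 𝒪[K] ⟨((ϖ ^ d₀)⁻¹ * (s i₀ - s j) * (d i₀ * (-(Matrix.diagonal d).det)⁻¹)), hCO⟩ = ((y i₀ - y j) * δ i₀) := by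
    rw [hypin i₀ ⟨_, htO i₀⟩ rfl, hypin j ⟨_, htO j⟩ rfl, hδpin i₀ ⟨_, hdcO⟩ rfl, ← map_sub, ← map_mul]
    congr 1
    apply Subtype.ext
    change ((ϖ ^ d₀)⁻¹ * (s i₀ - s j) * (d i₀ * (-(Matrix.diagonal d).det)⁻¹)) = ((ϖ ^ d₀)⁻¹ * (s i₀ - 1) - (ϖ ^ d₀)⁻¹ * (s j - 1)) * (d i₀ * (-(Matrix.diagonal d).det)⁻¹)
    ring
  have hnegc₁ : (⟨-c₁, neg_mem hc₁O⟩ : 𝒪[K]) = -⟨c₁, hc₁O⟩ := rfl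
  have hlockres : (∃ a : K, Valued.v a = 1 ∧ Valued.v (((ϖ ^ d₀)⁻¹ * (s i₀ - s j) * (d i₀ * (-(Matrix.diagonal d).det)⁻¹)) + c₁ * a ^ 2) < 1) ↔ ∃ a : 𝓀[K], a ≠ 0 ∧ ((y i₀ - y j) * δ i₀) = -(IsLocalRing.residue 𝒪[K] ⟨c₁, hc₁O⟩) * a ^ 2 := by
    have h := exists_unit_v_sub_mul_sq_lt_one_iff_residue ⟨((ϖ ^ d₀)⁻¹ * (s i₀ - s j) * (d i₀ * (-(Matrix.diagonal d).det)⁻¹)), hCO⟩ ⟨-c₁, neg_mem hc₁O⟩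
    rw [hCres, hnegc₁, map_neg] at h
    refine Iff.trans ?_ h
    refine exists_congr fun a => and_congr_right fun _ => ?_
    rw [show ((⟨((ϖ ^ d₀)⁻¹ * (s i₀ - s j) * (d i₀ * (-(Matrix.diagonal d).det)⁻¹)), hCO⟩ : 𝒪[K]) : K) - ((-⟨c₁, hc₁O⟩ : 𝒪[K]) : K) * a ^ 2 = ((ϖ ^ d₀)⁻¹ * (s i₀ - s j) * (d i₀ * (-(Matrix.diagonal d).det)⁻¹)) + c₁ * a ^ 2 by push_cast; ring]
  have hsqinv : ∀ c t : 𝓀[K], c ≠ 0 → ((∃ a : 𝓀[K], a ≠ 0 ∧ c * c * t = -(IsLocalRing.residue 𝒪[K] ⟨c₁, hc₁O⟩) * a ^ 2) ↔ ∃ a : 𝓀[K], a ≠ 0 ∧ t = -(IsLocalRing.residue 𝒪[K] ⟨c₁, hc₁O⟩) * a ^ 2) := by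
    intro c t hc
    constructor
    · rintro ⟨a, ha, h⟩
      exact ⟨a / c, div_ne_zero ha hc, by field_simp; linear_combination h⟩
    · rintro ⟨a, ha, h⟩
      exact ⟨a * c, mul_ne_zero ha hc, by rw [h]; ring⟩
  -- P: values in the class of `−c₁` — all `q + 1` root lines iff `lock`
  have hNP : ({c : {M : Submodule 𝒪[K] (Fin 3 → K) // IsVertex σ ϖ ((StdForm.antidiagonal 3).over K) M} | (latticeGraph σ ϖ ((StdForm.antidiagonal 3).over K)).Adj ⟨stdLattice K 3, 0, isSelfDualLattice_stdLattice_three_of_v hϖ⟩ c ∧ ∃ κ : unitaryGroupOfForm σ ((StdForm.antidiagonal 3).over K), κ ∈ unitaryInt σ ((StdForm.antidiagonal 3).over K) ∧ c = latticeGraphIso σ ϖ ((StdForm.antidiagonal 3).over K) κ ⟨latt (Matrix.diagonal ![(1 : K), 1, ϖ]), 2, isVertexLattice_two_N₁_of_neg hσϖ hϖ⟩ ∧ (∃ b : K, Valued.v b = 1 ∧ Valued.v (((ϖ ^ d₀)⁻¹ * pairing σ ((StdForm.antidiagonal 3).over K) (((κ : GL (Fin 3) K) : Matrix (Fin 3)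 (Fin 3) K) *ᵥ Pi.single 0 1) ((((γ : GL (Fin 3) K) : Matrix (Fin 3) (Fin 3) K) - 1) *ᵥ (((κ : GL (Fin 3) K) : Matrix (Fin 3) (Fin 3) K) *ᵥ Pi.single 0 1))) + c₁ * b ^ 2) < 1)}).ncard = if (∃ a : K, Valued.v a = 1 ∧ Valued.v (((ϖ ^ d₀)⁻¹ * (s i₀ - s j) * (d i₀ * (-(Matrix.diagonal d).det)⁻¹)) + c₁ * a ^ 2) < 1) then q + 1 else 0 := by
    have hk' := hkey (fun κ : unitaryGroupOfForm σ ((StdForm.antidiagonal 3).over K) => (∃ b : K, Valued.v b = 1 ∧ Valued.v (((ϖ ^ d₀)⁻¹ * pairing σ ((StdForm.antidiagonal 3).over K) (((κ : GL (Fin 3) K) : Matrix (Fin 3) (Fin 3) K) *ᵥ Pi.single 0 1) ((((γ : GL (Fin 3) K) : Matrix (Fin 3) (Fin 3) K) - 1) *ᵥ (((κ : GL (Fin 3) K) : Matrix (Fin 3) (Fin 3) K) *ᵥ Pi.single 0 1))) + c₁ * b ^ 2) < 1)) (fun t : 𝓀[K] => ∃ a : 𝓀[K], a ≠ 0 ∧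 t = -(IsLocalRing.residue 𝒪[K] ⟨c₁, hc₁O⟩) * a ^ 2) (fun κ hκ t ht => by
      have h := exists_unit_v_sub_mul_sq_lt_one_iff_residue t ⟨-c₁, neg_mem hc₁O⟩
      rw [hnegc₁, map_neg] at h
      refine Iff.trans ?_ h
      refine exists_congr fun b => and_congr_right fun _ => ?_
      rw [show ((t : 𝒪[K]) : K) - ((-⟨c₁, hc₁O⟩ : 𝒪[K]) : K) * b ^ 2 = ((ϖ ^ d₀)⁻¹ * pairing σ ((StdForm.antidiagonal 3).over K) (((κ : GL (Fin 3) K) : Matrix (Fin 3) (Fin 3) K) *ᵥ Pi.single 0 1) ((((γ : GL (Fin 3) K) : Matrix (Fin 3) (Fin 3) K) - 1) *ᵥ (((κ : GL (Fin 3) K) : Matrix (Fin 3) (Fin 3) K) *ᵥ Pi.single 0 1))) + c₁ * b ^ 2 by rw [ht]; push_cast; ring])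
    beta_reduce at hk'
    rw [hk', ncard_neighborSet_root_pred_eq_natCard hσ hvσ hσϖ hϖ hres h2 (d := d₀) (((γ : GL (Fin 3) K) : Matrix (Fin 3) (Fin 3) K) - 1) Y₀ hY₀ (fun t : 𝓀[K] => ∃ a : 𝓀[K], a ≠ 0 ∧ t = -(IsLocalRing.residue 𝒪[K] ⟨c₁, hc₁O⟩) * a ^ 2) hsqinv]
    have h := natCard_params_rootFrame_pred_eq hk2 (Ne.symm hj) (Ne.symm hk) hjk δ hδ0 y (hyeq j k hj hk) Ab (Y₀.map (IsLocalRing.residue 𝒪[K])) hG hY (fun t : 𝓀[K] => ∃ a : 𝓀[K], a ≠ 0 ∧ t = -(IsLocalRing.residue 𝒪[K] ⟨c₁, hc₁O⟩) * a ^ 2) hsqinv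
    have h0 : ¬ (∃ a : 𝓀[K], a ≠ 0 ∧ (0 : 𝓀[K]) = -(IsLocalRing.residue 𝒪[K] ⟨c₁, hc₁O⟩) * a ^ 2) := by
      rintro ⟨a, ha, h0⟩
      exact mul_ne_zero (neg_ne_zero.2 hc₁0) (pow_ne_zero 2 ha) h0.symm
    simp only [hχ, if_neg h0, mul_zero, zero_add] at h
    by_cases hl : (∃ a : K, Valued.v a = 1 ∧ Valued.v (((ϖ ^ d₀)⁻¹ * (s i₀ - s j) * (d i₀ * (-(Matrix.diagonal d).det)⁻¹)) + c₁ * a ^ 2) < 1)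
    · rw [if_pos hl]
      rw [if_pos (hlockres.1 hl)] at h
      have h' : ((Nat.card {p : Option {p : 𝓀[K] × 𝓀[K] // p.2 + (RingHom.id 𝓀[K]) p.2 + p.1 * (RingHom.id 𝓀[K]) p.1 = 0} //
          (fun t : 𝓀[K] => ∃ a : 𝓀[K], a ≠ 0 ∧ t = -(IsLocalRing.residue 𝒪[K] ⟨c₁, hc₁O⟩) * a ^ 2) ((p.elim (Pi.single 2 1) fun q => ![(1 : 𝓀[K]), q.1.1, q.1.2]) ⬝ᵥ
            ((((StdForm.antidiagonal 3).over 𝓀[K]) * Y₀.map (IsLocalRing.residue 𝒪[K])) *ᵥ (p.elim (Pi.single 2 1) fun q => ![(1 : 𝓀[K]), q.1.1, q.1.2])))} : ℕ) : ℤ) = ((q + 1 : ℕ) : ℤ) := by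
        rw [h, hq]; push_cast; ring
      exact_mod_cast h'
    · rw [if_neg hl]
      rw [if_neg (fun h' => hl (hlockres.2 h'))] at h
      have h' : ((Nat.card {p : Option {p : 𝓀[K] × 𝓀[K] // p.2 + (RingHom.id 𝓀[K]) p.2 + p.1 * (RingHom.id 𝓀[K]) p.1 = 0} //
          (fun t : 𝓀[K] => ∃ a : 𝓀[K], a ≠ 0 ∧ t = -(IsLocalRing.residue 𝒪[K] ⟨c₁, hc₁O⟩) * a ^ 2) ((p.elim (Pi.single 2 1) fun q => ![(1 : 𝓀[K]), q.1.1, q.1.2]) ⬝ᵥ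
            ((((StdForm.antidiagonal 3).over 𝓀[K]) * Y₀.map (IsLocalRing.residue 𝒪[K])) *ᵥ (p.elim (Pi.single 2 1) fun q => ![(1 : 𝓀[K]), q.1.1, q.1.2])))} : ℕ) : ℤ) = ((0 : ℕ) : ℤ) := by
        rw [h]; push_cast; ring
      exact_mod_cast h'
  -- M: unit values NOT in the class of `−c₁` — all `q + 1` root lines iff `¬lock`
  have hNM : ({c : {M : Submodule 𝒪[K] (Fin 3 → K) // IsVertex σ ϖ ((StdForm.antidiagonal 3).over K) M} | (latticeGraph σ ϖ ((StdForm.antidiagonal 3).over K)).Adj ⟨stdLattice K 3, 0, isSelfDualLattice_stdLattice_three_of_v hϖ⟩ c ∧ ∃ κ : unitaryGroupOfForm σ ((StdForm.antidiagonal 3).over K), κ ∈ unitaryInt σ ((StdForm.antidiagonal 3).over K) ∧ c = latticeGraphIso σ ϖ ((StdForm.antidiagonal 3).over K) κ ⟨latt (Matrix.diagonal ![(1 : K), 1, ϖ]), 2, isVertexLattice_two_N₁_of_neg hσϖ hϖ⟩ ∧ (Valued.v ((ϖ ^ d₀)⁻¹ * pairing σ ((StdForm.antidiagonal 3).over K)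 (((κ : GL (Fin 3) K) : Matrix (Fin 3) (Fin 3) K) *ᵥ Pi.single 0 1) ((((γ : GL (Fin 3) K) : Matrix (Fin 3) (Fin 3) K) - 1) *ᵥ (((κ : GL (Fin 3) K) : Matrix (Fin 3) (Fin 3) K) *ᵥ Pi.single 0 1))) = 1 ∧ ¬ ∃ b : K, Valued.v b = 1 ∧ Valued.v (((ϖ ^ d₀)⁻¹ * pairing σ ((StdForm.antidiagonal 3).over K) (((κ : GL (Fin 3) K) : Matrix (Fin 3) (Fin 3) K) *ᵥ Pi.single 0 1) ((((γ : GL (Fin 3) K) : Matrix (Fin 3) (Fin 3) K) - 1) *ᵥ (((κ : GL (Fin 3) K) : Matrix (Fin 3) (Fin 3) K) *ᵥ Pi.single 0 1))) + c₁ * b ^ 2) < 1)}).ncard = if (∃ a : K, Valued.v a = 1 ∧ Valued.v (((ϖ ^ d₀)⁻¹ * (s i₀ - s j) * (d i₀ * (-(Matrix.diagonal d).det)⁻¹)) + c₁ * a ^ 2) < 1) then 0 else q + 1 := by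
    have hPM' : ∀ c t : 𝓀[K], c ≠ 0 → ((fun t : 𝓀[K] => t ≠ 0 ∧ ¬ ∃ a : 𝓀[K], a ≠ 0 ∧ t = -(IsLocalRing.residue 𝒪[K] ⟨c₁, hc₁O⟩) * a ^ 2) (c * c * t) ↔ (fun t : 𝓀[K] => t ≠ 0 ∧ ¬ ∃ a : 𝓀[K], a ≠ 0 ∧ t = -(IsLocalRing.residue 𝒪[K] ⟨c₁, hc₁O⟩) * a ^ 2) t) := fun c t hc => by
      beta_reduce
      rw [hsqinv c t hc]
      exact and_congr_left fun _ => by simp [hc]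
    have hk' := hkey (fun κ : unitaryGroupOfForm σ ((StdForm.antidiagonal 3).over K) => (Valued.v ((ϖ ^ d₀)⁻¹ * pairing σ ((StdForm.antidiagonal 3).over K) (((κ : GL (Fin 3) K) : Matrix (Fin 3) (Fin 3) K) *ᵥ Pi.single 0 1) ((((γ : GL (Fin 3) K) : Matrix (Fin 3) (Fin 3) K) - 1) *ᵥ (((κ : GL (Fin 3) K) : Matrix (Fin 3) (Fin 3) K) *ᵥ Pi.single 0 1))) = 1 ∧ ¬ ∃ b : K, Valued.v b = 1 ∧ Valued.v (((ϖ ^ d₀)⁻¹ * pairing σ ((StdForm.antidiagonal 3).over K) (((κ : GL (Fin 3) K) : Matrix (Fin 3) (Fin 3) K) *ᵥ Pi.single 0 1) ((((γ : GL (Fin 3) K) : Matrix (Fin 3) (Fin 3) K) - 1) *ᵥ (((κ : GL (Fin 3) K) : Matrix (Fin 3) (Fin 3) K) *ᵥ Pi.single 0 1))) + c₁ * b ^ 2) < 1)) (fun t : 𝓀[K] => t ≠ 0 ∧ ¬ ∃ a : 𝓀[K], a ≠ 0 ∧ t = -(IsLocalRing.residue 𝒪[K] ⟨c₁, hc₁O⟩)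 * a ^ 2) (fun κ hκ t ht => by
      have h := exists_unit_v_sub_mul_sq_lt_one_iff_residue t ⟨-c₁, neg_mem hc₁O⟩
      rw [hnegc₁, map_neg] at h
      refine and_congr ?_ (not_congr (Iff.trans ?_ h))
      · rw [Ne, hres0, ht]
        constructor
        · intro h1; rw [h1]; exact lt_irrefl 1
        · intro hn; exact le_antisymm (by rw [← ht]; exact t.2) (not_lt.1 hn)
      · refine exists_congr fun b => and_congr_right fun _ => ?_
        rw [show ((t : 𝒪[K]) : K) - ((-⟨c₁, hc₁O⟩ : 𝒪[K]) : K) * b ^ 2 = ((ϖ ^ d₀)⁻¹ * pairing σ ((StdForm.antidiagonal 3).over K) (((κ : GL (Fin 3) K) : Matrix (Fin 3) (Fin 3) K) *ᵥ Pi.single 0 1) ((((γ : GL (Fin 3) K) : Matrix (Fin 3) (Fin 3) K) - 1) *ᵥ (((κ : GL (Fin 3) K) : Matrix (Fin 3) (Fin 3) K) *ᵥ Pi.single 0 1))) + c₁ * b ^ 2 by rw [ht]; push_cast; ring])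
    beta_reduce at hk'
    rw [hk', ncard_neighborSet_root_pred_eq_natCard hσ hvσ hσϖ hϖ hres h2 (d := d₀) (((γ : GL (Fin 3) K) : Matrix (Fin 3) (Fin 3) K) - 1) Y₀ hY₀ (fun t : 𝓀[K] => t ≠ 0 ∧ ¬ ∃ a : 𝓀[K], a ≠ 0 ∧ t = -(IsLocalRing.residue 𝒪[K] ⟨c₁, hc₁O⟩) * a ^ 2) hPM']
    have h := natCard_params_rootFrame_pred_eq hk2 (Ne.symm hj) (Ne.symm hk) hjk δ hδ0 y (hyeq j k hj hk) Ab (Y₀.map (IsLocalRing.residue 𝒪[K])) hG hY (fun t : 𝓀[K] => t ≠ 0 ∧ ¬ ∃ a : 𝓀[K], a ≠ 0 ∧ t = -(IsLocalRing.residue 𝒪[K] ⟨c₁, hc₁O⟩) * a ^ 2) hPM'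
    have h0 : ¬ ((0 : 𝓀[K]) ≠ 0 ∧ ¬ ∃ a : 𝓀[K], a ≠ 0 ∧ (0 : 𝓀[K]) = -(IsLocalRing.residue 𝒪[K] ⟨c₁, hc₁O⟩) * a ^ 2) := fun h => h.1 rfl
    simp only [hχ, if_neg h0, mul_zero, zero_add] at h
    by_cases hl : (∃ a : K, Valued.v a = 1 ∧ Valued.v (((ϖ ^ d₀)⁻¹ * (s i₀ - s j) * (d i₀ * (-(Matrix.diagonal d).det)⁻¹)) + c₁ * a ^ 2) < 1)
    · rw [if_pos hl]
      rw [if_neg (fun h' => h'.2 (hlockres.1 hl))] at h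
      have h' : ((Nat.card {p : Option {p : 𝓀[K] × 𝓀[K] // p.2 + (RingHom.id 𝓀[K]) p.2 + p.1 * (RingHom.id 𝓀[K]) p.1 = 0} //
          (fun t : 𝓀[K] => t ≠ 0 ∧ ¬ ∃ a : 𝓀[K], a ≠ 0 ∧ t = -(IsLocalRing.residue 𝒪[K] ⟨c₁, hc₁O⟩) * a ^ 2) ((p.elim (Pi.single 2 1) fun q => ![(1 : 𝓀[K]), q.1.1, q.1.2]) ⬝ᵥ
            ((((StdForm.antidiagonal 3).over 𝓀[K]) * Y₀.map (IsLocalRing.residue 𝒪[K])) *ᵥ (p.elim (Pi.single 2 1) fun q => ![(1 : 𝓀[K]), q.1.1, q.1.2])))} : ℕ) : ℤ) = ((0 : ℕ) : ℤ) := by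
        rw [h]; push_cast; ring
      exact_mod_cast h'
    · rw [if_neg hl]
      rw [if_pos ⟨hCne, fun h' => hl (hlockres.2 h')⟩] at h
      have h' : ((Nat.card {p : Option {p : 𝓀[K] × 𝓀[K] // p.2 + (RingHom.id 𝓀[K]) p.2 + p.1 * (RingHom.id 𝓀[K]) p.1 = 0} //
          (fun t : 𝓀[K] => t ≠ 0 ∧ ¬ ∃ a : 𝓀[K], a ≠ 0 ∧ t = -(IsLocalRing.residue 𝒪[K] ⟨c₁, hc₁O⟩) * a ^ 2) ((p.elim (Pi.single 2 1) fun q => ![(1 : 𝓀[K]), q.1.1, q.1.2]) ⬝ᵥ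
            ((((StdForm.antidiagonal 3).over 𝓀[K]) * Y₀.map (IsLocalRing.residue 𝒪[K])) *ᵥ (p.elim (Pi.single 2 1) fun q => ![(1 : 𝓀[K]), q.1.1, q.1.2])))} : ℕ) : ℤ) = ((q + 1 : ℕ) : ℤ) := by
        rw [h, hq]; push_cast; ring
      exact_mod_cast h'
  -- ### 7. the three ★ keyed slice counts at the root, and assembly over `sR = {r₀}`
  have hE := ncard_rootGrandchildren_sep_eq_mul_ncard_keyed hσ hvσ hσϖ hϖ hres h2 hT hγ0 hdeep (fun κ : unitaryGroupOfForm σ ((StdForm.antidiagonal 3).over K) => Valued.v ((ϖ ^ d₀)⁻¹ * pairing σ ((StdForm.antidiagonal 3).over K) (((κ : GL (Fin 3) K) : Matrix (Fin 3) (Fin 3) K) *ᵥ Pi.single 0 1) ((((γ : GL (Fin 3) K) : Matrix (Fin 3) (Fin 3) K) - 1) *ᵥ (((κ : GL (Fin 3) K) : Matrix (Fin 3) (Fin 3) K) *ᵥ Pi.single 0 1))) < 1) (fun w : {M : Submodule 𝒪[K] (Fin 3 → K) // IsVertex σ ϖ ((StdForm.antidiagonal 3).over K) M} => (¬ w.1.map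 ((Matrix.toLin' (((γ : GL (Fin 3) K) : Matrix (Fin 3) (Fin 3) K) - 1)).restrictScalars 𝒪[K]) ≤ scaleLattice (ϖ ^ d₀) w.1 ∧ (w.1.map ((Matrix.toLin' (((γ : GL (Fin 3) K) : Matrix (Fin 3) (Fin 3) K) - 1)).restrictScalars 𝒪[K]) ≤ scaleLattice (ϖ ^ (d₀ - 1)) w.1 ∧ ¬ w.1.map ((Matrix.toLin' (((γ : GL (Fin 3) K) : Matrix (Fin 3) (Fin 3) K) - 1)).restrictScalars 𝒪[K]) ≤ scaleLattice (ϖ ^ d₀) w.1))) hPκE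
  have hP := ncard_rootGrandchildren_sep_eq_mul_ncard_keyed hσ hvσ hσϖ hϖ hres h2 hT hγ0 hdeep (fun κ : unitaryGroupOfForm σ ((StdForm.antidiagonal 3).over K) => (∃ b : K, Valued.v b = 1 ∧ Valued.v (((ϖ ^ d₀)⁻¹ * pairing σ ((StdForm.antidiagonal 3).over K) (((κ : GL (Fin 3) K) : Matrix (Fin 3) (Fin 3) K) *ᵥ Pi.single 0 1) ((((γ : GL (Fin 3) K) : Matrix (Fin 3) (Fin 3) K) - 1) *ᵥ (((κ : GL (Fin 3) K) : Matrix (Fin 3) (Fin 3) K) *ᵥ Pi.single 0 1))) + c₁ * b ^ 2) < 1)) (fun w : {M : Submodule 𝒪[K] (Fin 3 → K) // IsVertex σ ϖ ((StdForm.antidiagonal 3).over K) M} => (¬ w.1.map ((Matrix.toLin' (((γ : GL (Fin 3) K) : Matrix (Fin 3) (Fin 3) K) - 1)).restrictScalars 𝒪[K]) ≤ scaleLattice (ϖ ^ d₀) w.1 ∧ (w.1.map ((Matrix.toLin' (((γ : GL (Fin 3) K) : Matrix (Fin 3) (Fin 3) K) - 1)).restrictScalars 𝒪[K]) ≤ scaleLattice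 (ϖ ^ (d₀ - 2)) w.1 ∧ ¬ w.1.map ((Matrix.toLin' (((γ : GL (Fin 3) K) : Matrix (Fin 3) (Fin 3) K) - 1)).restrictScalars 𝒪[K]) ≤ scaleLattice (ϖ ^ (d₀ - 1)) w.1) ∧ ∃ y ∈ w.1, ∃ a : K, Valued.v a = 1 ∧ Valued.v ((ϖ ^ (d₀ - 2))⁻¹ * pairing σ ((StdForm.antidiagonal 3).over K) y ((((γ : GL (Fin 3) K) : Matrix (Fin 3) (Fin 3) K) - 1) *ᵥ y) - (c₁) * a ^ 2) < 1)) hPκP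
  have hM := ncard_rootGrandchildren_sep_eq_mul_ncard_keyed hσ hvσ hσϖ hϖ hres h2 hT hγ0 hdeep (fun κ : unitaryGroupOfForm σ ((StdForm.antidiagonal 3).over K) => (Valued.v ((ϖ ^ d₀)⁻¹ * pairing σ ((StdForm.antidiagonal 3).over K) (((κ : GL (Fin 3) K) : Matrix (Fin 3) (Fin 3) K) *ᵥ Pi.single 0 1) ((((γ : GL (Fin 3) K) : Matrix (Fin 3) (Fin 3) K) - 1) *ᵥ (((κ : GL (Fin 3) K) : Matrix (Fin 3) (Fin 3) K) *ᵥ Pi.single 0 1))) = 1 ∧ ¬ ∃ b : K, Valued.v b = 1 ∧ Valued.v (((ϖ ^ d₀)⁻¹ * pairing σ ((StdForm.antidiagonal 3).over K) (((κ : GL (Fin 3) K) : Matrix (Fin 3) (Fin 3) K) *ᵥ Pi.single 0 1) ((((γ : GL (Fin 3) K) : Matrix (Fin 3) (Fin 3) K) - 1) *ᵥ (((κ : GL (Fin 3) K) : Matrix (Fin 3) (Fin 3) K) *ᵥ Pi.single 0 1))) + c₁ * b ^ 2) < 1)) (fun w : {M : Submodule 𝒪[K] (Fin 3 → K) // IsVertex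 σ ϖ ((StdForm.antidiagonal 3).over K) M} => (¬ w.1.map ((Matrix.toLin' (((γ : GL (Fin 3) K) : Matrix (Fin 3) (Fin 3) K) - 1)).restrictScalars 𝒪[K]) ≤ scaleLattice (ϖ ^ d₀) w.1 ∧ (w.1.map ((Matrix.toLin' (((γ : GL (Fin 3) K) : Matrix (Fin 3) (Fin 3) K) - 1)).restrictScalars 𝒪[K]) ≤ scaleLattice (ϖ ^ (d₀ - 2)) w.1 ∧ ¬ w.1.map ((Matrix.toLin' (((γ : GL (Fin 3) K) : Matrix (Fin 3) (Fin 3) K) - 1)).restrictScalars 𝒪[K]) ≤ scaleLattice (ϖ ^ (d₀ - 1)) w.1) ∧ ¬ (∃ y ∈ w.1, ∃ a : K, Valued.v a = 1 ∧ Valued.v ((ϖ ^ (d₀ - 2))⁻¹ * pairing σ ((StdForm.antidiagonal 3).over K) y ((((γ : GL (Fin 3) K) : Matrix (Fin 3) (Fin 3) K) - 1) *ᵥ y) - (c₁) * a ^ 2) < 1))) hPκM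
  rw [hqk] at hE hP hM
  rw [hNE] at hE
  rw [hNP] at hP
  rw [hNM] at hM
  refine ⟨by rw [hsR1, Finset.card_singleton], ?_, ?_, ?_⟩
  · rw [hsR1, Finset.sum_singleton]; exact hE
  · rw [hsR1, Finset.sum_singleton]; exact hP
  · rw [hsR1, Finset.sum_singleton]
    refine hM.trans ?_
    by_cases hl : (∃ a : K, Valued.v a = 1 ∧ Valued.v (((ϖ ^ d₀)⁻¹ * (s i₀ - s j) * (d i₀ * (-(Matrix.diagonal d).det)⁻¹)) + c₁ * a ^ 2) < 1) <;> simp only [hl, if_true, if_false]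

end Literature.NumberTheory.Automorphic.UnitaryLatticeTree

end
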